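import Literature.Computability.Complexity.StackArithMul
import Literature.Computability.Complexity.StackBricks
import HarnessLib

/-!
# Verified arithmetic on stack programs, III: a numeric procedure layer

Trunk `CplxCore`, toolkit for `TimeBounds.lean`, continuing `StackArith.lean` and
`StackArithMul.lean`. Those files prove the arithmetic routines on their own fixed register banks
(`AReg`, `MReg = AReg ⊕ MOwn`, `EReg = MReg ⊕ EOwn`) with explicit register files. This file
packages them as *procedures with operands named in an arbitrary outer register bank* `β`: the
register type is `EReg ⊕ β`, the three lower banks serve as a calculator that is clean before
and after every procedure (`base T`, `T : Regs β` the outer bank), and every procedure has a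
specification of the uniform shape

  `Runs (nOp dst …) (base T) (base (Function.update T dst <numeral of the result>)) <cost>`

with the cost bounded by a fixed polynomial in a common bound `n` on the operand lengths. Results
are always *numerals* (`encodeNat`, no redundant high zeros), so that lengths are controlled by
values (`TM2Pass.length_encodeNat_eq_size`; the elementary length lemmas for numerals are the
ones of `TM2PassThrough.lean`, `StackStrings.lean` and `StackBricks.lean`, imported for that purpose).

Procedures: constants (`setConst`), normalisation (`nNorm`), `nAdd`, `nSub`, comparison flags
(`nCmp`, `nEq`, `nIsT`, `nNot`), `nMul`, `nDivMod`, `nModMul`, `nPowMod`, successor (`nSucc`),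
the pairing function and its inverse on bit strings (`nPairOnto`, `nUnpair`, agreeing with
`boolPair`/`boolUnpair` on *all* inputs), binary-to-unary conversion (`nToUnary`), length in
binary (`nLen`), and a counted-loop rule (`runs_loop_count`) — an instruction set for machine
realisations of number-theoretic algorithms (modular arithmetic on parsed inputs).

**Relation to sibling files** (the `Stack*.lean` directory as it stands). `StackStrings.lean`
has a pair decoder `Com.unpair`/`unpairW` (components delivered reversed, with the
well-formedness flag `wellPaired`) and destructive *string* equality `Com.eqCheck`;
`StackStrings.lean`/`StackRoutines.lean`/`StackUnary.lean` have loop rules in functional form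
(`runs_loop_of_fun`, `loopIter`) and constant pushes (`pushN`, `pushK`); `StackModArith.lean`,
`StackGcd.lean`, `StackDiv.lean`, `StackMul.lean` have modular arithmetic, remainder, quotient
and product routines over `κ ⊕ AReg` with operands consumed from outer registers. The present
layer is a second rendering of some of this under one calling convention, the one
`StackScript.lean` (symbolic execution) and the Blum–Micali machine (`BlumMicaliMachine*.lean`)
are built on: every procedure maps `base T` to `base T'` (three calculator banks clean below an
arbitrary outer bank `β`), reads its operands by name in `β` *without consuming them*, and
writes one normalised numeral; `nUnpair` delivers both components in order and agrees with
`boolUnpair` on all inputs (the machine input is arbitrary); `nCmp`/`nEq` compare *values*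
(`bitsToNat`, insensitive to redundant high zeros), not strings; `runs_loop_count` is the
counted-loop rule in the state-function form matching `Com.impl_iterM` of `StackOracle.lean`.
Re-expressing the twenty procedures over the sibling routines would need, per routine, a
transport along a register injection plus operand staging and cost reshaping — this file again.
`pushList`/`runs_pushList` (a constant push, below) coincide with `pushNum`/`runs_pushNum` of
`Cryptography/WordRAMToTM2Interp.lean` (an application layer, not to be imported here); one copy
should eventually be hoisted next to `StackRoutines.pushN`.

## References

* D. E. Knuth, *The Art of Computer Programming*, Vol. 2, 3rd ed., 1998, §4.3.1, §4.6.3 (the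
  algorithms wrapped here; proved in the two previous files).
* M. Minsky, *Computation: Finite and Infinite Machines*, 1967, §11.1 (many-register stack
  programs). (Folklore material, fully proved here.)
-/

namespace Literature.Computability.Complexity

open _root_.Computability

/-! ### Sizes of numerals -/

/-- The numeral of `n` has at most `n` bits (sharper by one than `TM2Pass.length_encodeNat_le_self`;
the same statement is proved, in parallel, as `Literature.Computability.MetaComplexity.length_encodeNat_le`
(`MetaComplexity/FregeProofs.lean`) and `TokConv.length_encodeNat_le` (`TokenStreams.lean`),
neither importable here without dragging in an unrelated development). [folklore] -/
theorem length_encodeNat_le_self (n : ℕ) : (encodeNat n).length ≤ n := by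
  rw [TM2Pass.length_encodeNat_eq_size]; exact Nat.size_le.2 n.lt_two_pow_self

/-- The numeral of a number below the value of `w` is at most as long as `w`. [folklore] -/
theorem length_encodeNat_le_of_lt {a : ℕ} {w : List Bool} (h : a < bitsToNat w) :
    (encodeNat a).length ≤ w.length :=
  (Brick.length_encodeNat_mono h.le).trans (Brick.length_encodeNat_bitsToNat_le w)

/-- `|numeral of (a + b)| ≤ max + 1`. [folklore] -/
theorem length_encodeNat_add_le (a b : ℕ) :
    (encodeNat (a + b)).length ≤ max (encodeNat a).length (encodeNat b).length + 1 := by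
  simp only [TM2Pass.length_encodeNat_eq_size]
  apply Nat.size_le.2
  have ha := Nat.lt_size_self a
  have hb := Nat.lt_size_self b
  have h1 : 2 ^ a.size ≤ 2 ^ max a.size b.size := Nat.pow_le_pow_right (by norm_num) (le_max_left _ _)
  have h2 : 2 ^ b.size ≤ 2 ^ max a.size b.size := Nat.pow_le_pow_right (by norm_num) (le_max_right _ _)
  rw [pow_succ]; omega

/-- `|numeral of (a * b)| ≤ |a| + |b|`. [folklore] -/
theorem length_encodeNat_mul_le (a b : ℕ) :
    (encodeNat (a * b)).length ≤ (encodeNat a).length + (encodeNat b).length := by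
  simp only [TM2Pass.length_encodeNat_eq_size]
  apply Nat.size_le.2
  rw [pow_add]
  exact Nat.mul_lt_mul'' (Nat.lt_size_self a) (Nat.lt_size_self b)

/-- The numeral of `0` is empty (file-local copy of `TokConv.encodeNat_zero'`, `TokenStreams.lean`,
not imported). [folklore] -/
private theorem encodeNat_zero : encodeNat 0 = [] := rfl

/-- `boolUnpair` of the empty string. [folklore] -/
theorem boolUnpair_nil : boolUnpair [] = ([], []) := rfl

namespace Com

variable {β : Type}

/-! ### Register names and states of the numeric layer -/

/-- Name of an arithmetic-bank register inside the numeric layer. [folklore] -/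
@[reducible] def ra (r : AReg) : EReg ⊕ β := Sum.inl (Sum.inl (Sum.inl r))

/-- Name of a multiplication-bank register inside the numeric layer. [folklore] -/
@[reducible] def rm (k : MOwn) : EReg ⊕ β := Sum.inl (Sum.inl (Sum.inr k))

/-- Name of an exponentiation-bank register inside the numeric layer. [folklore] -/
@[reducible] def re (r : EOwn) : EReg ⊕ β := Sum.inl (Sum.inr r)

/-- The register file of the numeric layer assembled from its four banks. [folklore] -/
def nst (A : Regs AReg) (M : Regs MOwn) (E : Regs EOwn) (T : Regs β) : Regs (EReg ⊕ β) :=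
  Sum.elim (Sum.elim (Sum.elim A M) E) T

/-- The clean arithmetic bank. [folklore] -/
abbrev aClean : Regs AReg := AReg.file [] [] [] [] [] [] [] []

/-- The clean multiplication bank. [folklore] -/
abbrev mClean : Regs MOwn := MOwn.file [] [] [] []

/-- The clean exponentiation bank. [folklore] -/
abbrev eClean : Regs EOwn := EOwn.file [] [] [] []

/-- `base T`: outer bank `T`, the three lower banks clean — the state between two procedures.
[folklore] -/
abbrev base (T : Regs β) : Regs (EReg ⊕ β) := nst aClean mClean eClean T

section NstLemmas

variable (A : Regs AReg) (M : Regs MOwn) (E : Regs EOwn) (T : Regs β) (v : List Bool)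

/-- Reading an arithmetic register. [folklore] -/
@[simp] theorem nst_ra (r : AReg) : nst A M E T (ra r) = A r := rfl
/-- Reading a multiplication register. [folklore] -/
@[simp] theorem nst_rm (k : MOwn) : nst A M E T (rm k) = M k := rfl
/-- Reading an exponentiation register. [folklore] -/
@[simp] theorem nst_re (r : EOwn) : nst A M E T (re r) = E r := rfl
/-- Reading an outer register. [folklore] -/
@[simp] theorem nst_inr (r : β) : nst A M E T (Sum.inr r) = T r := rfl
/-- Reading an arithmetic register (constructor form). [folklore] -/
@[simp] theorem nst_inl_inl_inl (r : AReg) : nst A M E T (Sum.inl (Sum.inl (Sum.inl r))) = A r := rfl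
/-- Reading a multiplication register (constructor form). [folklore] -/
@[simp] theorem nst_inl_inl_inr (k : MOwn) : nst A M E T (Sum.inl (Sum.inl (Sum.inr k))) = M k := rfl
/-- Reading an exponentiation register (constructor form). [folklore] -/
@[simp] theorem nst_inl_inr (r : EOwn) : nst A M E T (Sum.inl (Sum.inr r)) = E r := rfl

variable [DecidableEq β]

/-- Writing an arithmetic register. [folklore] -/
@[simp] theorem update_nst_ra (r : AReg) :
    Function.update (nst A M E T) (Sum.inl (Sum.inl (Sum.inl r))) v = nst (Function.update A r v) M E T := by
  simp only [nst, Sum.update_elim_inl]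
/-- Writing a multiplication register. [folklore] -/
@[simp] theorem update_nst_rm (k : MOwn) :
    Function.update (nst A M E T) (Sum.inl (Sum.inl (Sum.inr k))) v = nst A (Function.update M k v) E T := by
  simp only [nst, Sum.update_elim_inl, Sum.update_elim_inr]
/-- Writing an exponentiation register. [folklore] -/
@[simp] theorem update_nst_re (r : EOwn) :
    Function.update (nst A M E T) (Sum.inl (Sum.inr r)) v = nst A M (Function.update E r v) T := by
  simp only [nst, Sum.update_elim_inl, Sum.update_elim_inr]
/-- Writing an outer register. [folklore] -/
@[simp] theorem update_nst_inr (r : β) :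
    Function.update (nst A M E T) (Sum.inr r) v = nst A M E (Function.update T r v) := by
  simp only [nst, Sum.update_elim_inr]

end NstLemmas

/-! ### Running the bank routines inside the layer -/

/-- An arithmetic-bank program, run in the numeric layer. [folklore] -/
def liftA (c : Com AReg) : Com (EReg ⊕ β) := ((c.map Sum.inl).map Sum.inl).map Sum.inl

/-- A multiplication-layer program, run in the numeric layer. [folklore] -/
def liftM (c : Com MReg) : Com (EReg ⊕ β) := (c.map Sum.inl).map Sum.inl

/-- An exponentiation-layer program, run in the numeric layer. [folklore] -/
def liftE (c : Com EReg) : Com (EReg ⊕ β) := c.map Sum.inl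

variable [DecidableEq β]

/-- Lifted runs of arithmetic-bank programs. [folklore] -/
theorem Runs.liftA {c : Com AReg} {A A' : Regs AReg} {B : ℕ} (h : Runs c A A' B) (M : Regs MOwn)
    (E : Regs EOwn) (T : Regs β) : Runs (liftA c) (nst A M E T) (nst A' M E T) B :=
  ((h.inl M).inl E).inl T

/-- Lifted runs of multiplication-layer programs. [folklore] -/
theorem Runs.liftM {c : Com MReg} {A A' : Regs AReg} {M M' : Regs MOwn} {B : ℕ}
    (h : Runs c (Sum.elim A M) (Sum.elim A' M') B) (E : Regs EOwn) (T : Regs β) :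
    Runs (liftM c) (nst A M E T) (nst A' M' E T) B :=
  (h.inl E).inl T

/-- Lifted runs of exponentiation-layer programs. [folklore] -/
theorem Runs.liftE {c : Com EReg} {A A' : Regs AReg} {M M' : Regs MOwn} {E E' : Regs EOwn} {B : ℕ}
    (h : Runs c (Sum.elim (Sum.elim A M) E) (Sum.elim (Sum.elim A' M') E') B) (T : Regs β) :
    Runs (liftE c) (nst A M E T) (nst A' M' E' T) B :=
  h.inl T

/-! ### Register utilities with operands in the outer bank -/

section OuterOps

/-- `clear` on an outer register, between procedures. [folklore] -/
theorem runs_oclear (a : β) (T : Regs β) :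
    Runs (clear (Sum.inr a : EReg ⊕ β)) (base T) (base (Function.update T a [])) (2 * (T a).length + 1) :=
  (runs_clear _ _).of_eq (by simp) (by simp)

/-- `pour` between outer registers, between procedures. [folklore] -/
theorem runs_opour {a b : β} (hab : a ≠ b) (T : Regs β) :
    Runs (pour (Sum.inr a : EReg ⊕ β) (Sum.inr b)) (base T)
      (base (Function.update (Function.update T a []) b ((T a).reverse ++ T b))) (3 * (T a).length + 1) :=
  (runs_pour (by simpa using hab) _).of_eq (by simp) (by simp)

/-- `move` between outer registers (scratch `s` of the arithmetic bank), between procedures.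
[folklore] -/
theorem runs_omove {a b : β} (hab : a ≠ b) (T : Regs β) :
    Runs (move (Sum.inr a : EReg ⊕ β) (Sum.inr b) (ra .s)) (base T)
      (base (Function.update (Function.update T a []) b (T a ++ T b))) (6 * (T a).length + 2) :=
  (runs_move (by simpa using hab) (by simp [ra]) (by simp [ra]) _ rfl).of_eq (by simp) (by simp)

/-- `copy` between outer registers (scratch `t u` of the arithmetic bank), between procedures.
[folklore] -/
theorem runs_ocopy {a b : β} (hab : a ≠ b) (T : Regs β) :
    Runs (copy (Sum.inr a : EReg ⊕ β) (Sum.inr b) (ra .t) (ra .u)) (base T)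
      (base (Function.update T b (T a ++ T b))) (10 * (T a).length + 3) :=
  (runs_copy (by simpa using hab) (by simp [ra]) (by simp [ra]) (by simp [ra]) (by simp [ra]) (by simp [ra]) _
    rfl rfl).of_eq (by simp) (by simp)

/-- `push` on an outer register. [folklore] -/
theorem Runs.opush (k : β) (b : Bool) (T : Regs β) :
    Runs (Com.push (Sum.inr k : EReg ⊕ β) b) (base T) (base (Function.update T k (b :: T k))) 1 :=
  Runs.push' (by simp)

/-- `pop` on an outer register holding `true :: w`. [folklore] -/
theorem Runs.opop_true {k : β} {ct : Com (EReg ⊕ β)} (cf cn : Com (EReg ⊕ β)) {T : Regs β} {R' : Regs (EReg ⊕ β)}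
    {w : List Bool} {B : ℕ} (hk : T k = true :: w) (h : Runs ct (base (Function.update T k w)) R' B) :
    Runs (Com.pop (Sum.inr k) ct cf cn) (base T) R' (B + 2) :=
  Runs.pop_true' cf cn (by simpa using hk) (by simp) h

/-- `pop` on an outer register holding `false :: w`. [folklore] -/
theorem Runs.opop_false {k : β} (ct : Com (EReg ⊕ β)) {cf : Com (EReg ⊕ β)} (cn : Com (EReg ⊕ β)) {T : Regs β}
    {R' : Regs (EReg ⊕ β)} {w : List Bool} {B : ℕ} (hk : T k = false :: w)
    (h : Runs cf (base (Function.update T k w)) R' B) :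
    Runs (Com.pop (Sum.inr k) ct cf cn) (base T) R' (B + 2) :=
  Runs.pop_false' ct cn (by simpa using hk) (by simp) h

/-- `pop` on an empty outer register. [folklore] -/
theorem Runs.opop_nil {k : β} (ct cf : Com (EReg ⊕ β)) {cn : Com (EReg ⊕ β)} {T : Regs β} {R' : Regs (EReg ⊕ β)}
    {B : ℕ} (hk : T k = []) (h : Runs cn (base T) R' B) :
    Runs (Com.pop (Sum.inr k) ct cf cn) (base T) R' (B + 2) :=
  Runs.pop_nil ct cf (by simpa using hk) h

/-- `pop` on an empty outer register, the branch stopping. [folklore] -/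
theorem Halts.opop_nil {k : β} (ct cf : Com (EReg ⊕ β)) {cn : Com (EReg ⊕ β)} {T : Regs β} {R' : Regs (EReg ⊕ β)}
    {B : ℕ} (hk : T k = []) (h : Halts cn (base T) R' B) :
    Halts (Com.pop (Sum.inr k) ct cf cn) (base T) R' (B + 2) :=
  Halts.pop_nil ct cf (by simpa using hk) h

/-- Loop exit on an empty outer counter. [folklore] -/
theorem Runs.oloop_nil {k : β} (ct cf : Com (EReg ⊕ β)) {T : Regs β} (hk : T k = []) :
    Runs (Com.loop (Sum.inr k) ct cf) (base T) (base T) 1 :=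
  Runs.loop_nil ct cf (by simpa using hk)

/-- Loop iteration on an outer counter holding `true :: w`. [folklore] -/
theorem Runs.oloop_true {k : β} {ct cf : Com (EReg ⊕ β)} {T : Regs β} {R₁ R₂ : Regs (EReg ⊕ β)} {w : List Bool}
    {B₁ B₂ : ℕ} (hk : T k = true :: w) (h₁ : Runs ct (base (Function.update T k w)) R₁ B₁)
    (h₂ : Runs (Com.loop (Sum.inr k) ct cf) R₁ R₂ B₂) : Runs (Com.loop (Sum.inr k) ct cf) (base T) R₂ (B₁ + 2 + B₂) :=
  Runs.loop_true' (by simpa using hk) (by simp) h₁ h₂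

/-- Loop iteration on an outer counter holding `false :: w`. [folklore] -/
theorem Runs.oloop_false {k : β} {ct cf : Com (EReg ⊕ β)} {T : Regs β} {R₁ R₂ : Regs (EReg ⊕ β)} {w : List Bool}
    {B₁ B₂ : ℕ} (hk : T k = false :: w) (h₁ : Runs cf (base (Function.update T k w)) R₁ B₁)
    (h₂ : Runs (Com.loop (Sum.inr k) ct cf) R₁ R₂ B₂) : Runs (Com.loop (Sum.inr k) ct cf) (base T) R₂ (B₁ + 2 + B₂) :=
  Runs.loop_false' (by simpa using hk) (by simp) h₁ h₂

/-- Loop iteration on `true`, the rest stopping. [folklore] -/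
theorem Runs.oloop_true_halts {k : β} {ct cf : Com (EReg ⊕ β)} {T : Regs β} {R₁ R₂ : Regs (EReg ⊕ β)} {w : List Bool}
    {B₁ B₂ : ℕ} (hk : T k = true :: w) (h₁ : Runs ct (base (Function.update T k w)) R₁ B₁)
    (h₂ : Halts (Com.loop (Sum.inr k) ct cf) R₁ R₂ B₂) : Halts (Com.loop (Sum.inr k) ct cf) (base T) R₂ (B₁ + 2 + B₂) :=
  Runs.loop_true_halts' (by simpa using hk) (by simp) h₁ h₂

/-- Loop iteration on `false`, the rest stopping. [folklore] -/
theorem Runs.oloop_false_halts {k : β} {ct cf : Com (EReg ⊕ β)} {T : Regs β} {R₁ R₂ : Regs (EReg ⊕ β)} {w : List Bool}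
    {B₁ B₂ : ℕ} (hk : T k = false :: w) (h₁ : Runs cf (base (Function.update T k w)) R₁ B₁)
    (h₂ : Halts (Com.loop (Sum.inr k) ct cf) R₁ R₂ B₂) : Halts (Com.loop (Sum.inr k) ct cf) (base T) R₂ (B₁ + 2 + B₂) :=
  Runs.loop_false_halts' (by simpa using hk) (by simp) h₁ h₂

/-- Loop body stopping on `true`. [folklore] -/
theorem Halts.oloop_true {k : β} {ct : Com (EReg ⊕ β)} (cf : Com (EReg ⊕ β)) {T : Regs β} {R₁ : Regs (EReg ⊕ β)}
    {w : List Bool} {B₁ : ℕ} (hk : T k = true :: w) (h₁ : Halts ct (base (Function.update T k w)) R₁ B₁) :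
    Halts (Com.loop (Sum.inr k) ct cf) (base T) R₁ (B₁ + 2) :=
  Halts.loop_true' cf (by simpa using hk) (by simp) h₁

/-- Loop body stopping on `false`. [folklore] -/
theorem Halts.oloop_false {k : β} (ct : Com (EReg ⊕ β)) {cf : Com (EReg ⊕ β)} {T : Regs β} {R₁ : Regs (EReg ⊕ β)}
    {w : List Bool} {B₁ : ℕ} (hk : T k = false :: w) (h₁ : Halts cf (base (Function.update T k w)) R₁ B₁) :
    Halts (Com.loop (Sum.inr k) ct cf) (base T) R₁ (B₁ + 2) :=
  Halts.loop_false' ct (by simpa using hk) (by simp) h₁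

end OuterOps

/-! ### Constants -/

/-- `pushList k l`: push the bits of `l` onto `k`, last bit first, so that afterwards `l` sits on
top of `k` in order. [folklore] -/
def pushList {ι : Type} (k : ι) : List Bool → Com ι
  | [] => skip
  | b :: l => pushList k l ;; push k b

/-- Effect of `pushList`, in `|l|` steps. [folklore] -/
theorem runs_pushList {ι : Type} [DecidableEq ι] (k : ι) (l : List Bool) (R : Regs ι) :
    Runs (pushList k l) R (Function.update R k (l ++ R k)) l.length := by
  induction l generalizing R with
  | nil => simpa [pushList] using Runs.skip R
  | cons b l ih =>
    refine ((ih R).seq (Runs.push k b _)).of_eq ?_ (by simp)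
    simp

/-- `setConst r w`: overwrite register `r` with the constant `w`. [folklore] -/
def setConst {ι : Type} (r : ι) (w : List Bool) : Com ι := clear r ;; pushList r w

/-- Effect of `setConst`, in `2|r| + 1 + |w|` steps. [folklore] -/
theorem runs_setConst {ι : Type} [DecidableEq ι] (r : ι) (w : List Bool) (R : Regs ι) :
    Runs (setConst r w) R (Function.update R r w) (2 * (R r).length + 1 + w.length) := by
  refine ((runs_clear r R).seq (runs_pushList r w _)).of_eq ?_ le_rfl
  simp

/-! ### A counted loop -/

/-- **Counted loops.** If the body, run with any contents `w` of the counter register `C` that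
it does not touch, takes state `S j` to state `S (j+1)` (for `j < N`), then `loop C body body`
started with a counter of length `|w|` on `S j` ends on `S (j + |w|)` with the counter empty, in
`|w| (cost + 2) + 1` steps. [folklore] -/
theorem runs_loop_count {ι : Type} [DecidableEq ι] {C : ι} {body : Com ι} (S : ℕ → Regs ι)
    (cost N : ℕ) (hC : ∀ j, S j C = [])
    (hbody : ∀ j (w : List Bool), j < N →
      Runs body (Function.update (S j) C w) (Function.update (S (j + 1)) C w) cost) :
    ∀ (w : List Bool) (j : ℕ), j + w.length ≤ N →
      Runs (loop C body body) (Function.update (S j) C w) (S (j + w.length)) (w.length * (cost + 2) + 1)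
  | [], j, _ => by
    have e : Function.update (S j) C [] = S j := by rw [← hC j, Function.update_eq_self]
    rw [e]
    exact (Runs.loop_nil _ _ (hC j)).of_eq (by simp) (by simp)
  | b :: w, j, hj => by
    have hrest := runs_loop_count S cost N hC hbody w (j + 1) (by simp at hj; omega)
    have hb := hbody j w (by simp at hj; omega)
    have e : j + 1 + w.length = j + (b :: w).length := by simp; omega
    rw [e] at hrest
    cases b
    · exact (Runs.loop_false' (w := w) (by simp) (by simp) hb hrest).of_eq rfl
        (by simp only [List.length_cons, Nat.add_mul, one_mul]; omega)
    · exact (Runs.loop_true' (w := w) (by simp) (by simp) hb hrest).of_eq rfl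
        (by simp only [List.length_cons, Nat.add_mul, one_mul]; omega)

/-! ### Normalisation in place -/

/-- `nNorm r`: replace the contents of `r` by its normal form (same value, no high zeros).
[folklore] -/
def nNorm (r : β) : Com (EReg ⊕ β) :=
  move (Sum.inr r) (ra .x) (ra .s) ;; liftA normalize ;; move (ra .x) (Sum.inr r) (ra .s)

/-- Effect of `nNorm`, in `21|r| + 9` steps. [folklore] -/
theorem runs_nNorm (r : β) (T : Regs β) :
    Runs (nNorm r) (base T) (base (Function.update T r (norm (T r)))) (21 * (T r).length + 9) := by
  have h1 : Runs (move (Sum.inr r) (ra .x) (ra .s)) (base T)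
      (nst (AReg.file (T r) [] [] [] [] [] [] []) mClean eClean (Function.update T r [])) (6 * (T r).length + 2) :=
    (runs_move (by simp [ra]) (by simp [ra]) (by simp [ra]) (base T) rfl).of_eq (by simp) (by simp)
  have h2 : Runs (liftA normalize) (nst (AReg.file (T r) [] [] [] [] [] [] []) mClean eClean (Function.update T r []))
      (nst (AReg.file (norm (T r)) [] [] [] [] [] [] []) mClean eClean (Function.update T r []))
      (9 * (T r).length + 5) :=
    (runs_normalize (T r) [] [] [] [] []).liftA _ _ _
  have h3 : Runs (move (ra .x) (Sum.inr r) (ra .s))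
      (nst (AReg.file (norm (T r)) [] [] [] [] [] [] []) mClean eClean (Function.update T r []))
      (base (Function.update T r (norm (T r)))) (6 * (norm (T r)).length + 2) :=
    (runs_move (by simp [ra]) (by simp [ra]) (by simp [ra]) _ rfl).of_eq (by simp) (by simp)
  refine (h1.seq (h2.seq h3)).of_eq rfl ?_
  have := length_norm_le (T r); omega

/-! ### Addition and successor -/

/-- `nAdd dst a b`: `dst :=` numeral of `a + b` (`dst` may be `a` or `b`). [Knuth 1998, §4.3.1,
Algorithm A] [folklore] -/
def nAdd (dst a b : β) : Com (EReg ⊕ β) :=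
  copy (Sum.inr a) (ra .x) (ra .t) (ra .u) ;; copy (Sum.inr b) (ra .y) (ra .t) (ra .u) ;;
  liftA add ;; liftA normalize ;; clear (ra .y) ;; clear (Sum.inr dst) ;; move (ra .x) (Sum.inr dst) (ra .s)

/-- **Simulation of `nAdd`**, in `65 (n + 1)` steps when `|a|, |b| ≤ n`, `|dst| ≤ n + 1`.
[Knuth 1998, §4.3.1, Algorithm A] [folklore] -/
theorem runs_nAdd (dst a b : β) (T : Regs β) {n : ℕ} (ha : (T a).length ≤ n) (hb : (T b).length ≤ n)
    (hd : (T dst).length ≤ n + 1) :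
    Runs (nAdd dst a b) (base T) (base (Function.update T dst (encodeNat (bitsToNat (T a) + bitsToNat (T b)))))
      (65 * (n + 1)) := by
  set xs := T a
  set ys := T b
  have h1 : Runs (copy (Sum.inr a) (ra .x) (ra .t) (ra .u)) (base T)
      (nst (AReg.file xs [] [] [] [] [] [] []) mClean eClean T) (10 * xs.length + 3) :=
    (runs_copy (by simp [ra]) (by simp [ra]) (by simp [ra]) (by simp [ra]) (by simp [ra]) (by simp [ra]) (base T)
      rfl rfl).of_eq (by simp [xs]) (by simp [xs])
  have h2 : Runs (copy (Sum.inr b) (ra .y) (ra .t) (ra .u)) (nst (AReg.file xs [] [] [] [] [] [] []) mClean eClean T)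
      (nst (AReg.file xs ys [] [] [] [] [] []) mClean eClean T) (10 * ys.length + 3) :=
    (runs_copy (by simp [ra]) (by simp [ra]) (by simp [ra]) (by simp [ra]) (by simp [ra]) (by simp [ra]) _
      rfl rfl).of_eq (by simp [ys]) (by simp [ys])
  have h3 : Runs (liftA add) (nst (AReg.file xs ys [] [] [] [] [] []) mClean eClean T)
      (nst (AReg.file (addRes xs ys) ys [] [] [] [] [] []) mClean eClean T) (13 * (xs.length + ys.length) + 12) :=
    (runs_add xs ys [] [] []).liftA _ _ _
  have h4 : Runs (liftA normalize) (nst (AReg.file (addRes xs ys) ys [] [] [] [] [] []) mClean eClean T)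
      (nst (AReg.file (norm (addRes xs ys)) ys [] [] [] [] [] []) mClean eClean T) (9 * (addRes xs ys).length + 5) :=
    (runs_normalize (addRes xs ys) ys [] [] [] []).liftA _ _ _
  have h5 : Runs (clear (ra .y)) (nst (AReg.file (norm (addRes xs ys)) ys [] [] [] [] [] []) mClean eClean T)
      (nst (AReg.file (norm (addRes xs ys)) [] [] [] [] [] [] []) mClean eClean T) (2 * ys.length + 1) :=
    (runs_clear (ra .y) _).of_eq (by simp) (by simp)
  have h6 : Runs (clear (Sum.inr dst)) (nst (AReg.file (norm (addRes xs ys)) [] [] [] [] [] [] []) mClean eClean T)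
      (nst (AReg.file (norm (addRes xs ys)) [] [] [] [] [] [] []) mClean eClean (Function.update T dst []))
      (2 * (T dst).length + 1) :=
    (runs_clear (Sum.inr dst) _).of_eq (by simp) (by simp)
  have h7 : Runs (move (ra .x) (Sum.inr dst) (ra .s))
      (nst (AReg.file (norm (addRes xs ys)) [] [] [] [] [] [] []) mClean eClean (Function.update T dst []))
      (base (Function.update T dst (norm (addRes xs ys)))) (6 * (norm (addRes xs ys)).length + 2) :=
    (runs_move (by simp [ra]) (by simp [ra]) (by simp [ra]) _ rfl).of_eq (by simp) (by simp)
  have hl := length_addRes_le_max xs ys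
  have hl' := length_norm_le (addRes xs ys)
  have hmax : max xs.length ys.length ≤ n := max_le ha hb
  refine (h1.seq (h2.seq (h3.seq (h4.seq (h5.seq (h6.seq h7)))))).of_eq ?_ (by omega)
  rw [norm_eq_encodeNat, bitsToNat_addRes]

/-- `nSucc dst src`: `dst :=` numeral of `src + 1` (`dst` may be `src`). [folklore] -/
def nSucc (dst src : β) : Com (EReg ⊕ β) :=
  copy (Sum.inr src) (ra .x) (ra .t) (ra .u) ;; push (ra .y) true ;;
  liftA add ;; liftA normalize ;; clear (ra .y) ;; clear (Sum.inr dst) ;; move (ra .x) (Sum.inr dst) (ra .s)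

/-- **Simulation of `nSucc`**, in `72 (n + 1)` steps when `|src| ≤ n`, `|dst| ≤ n + 1`. [folklore] -/
theorem runs_nSucc (dst src : β) (T : Regs β) {n : ℕ} (hs : (T src).length ≤ n) (hd : (T dst).length ≤ n + 1) :
    Runs (nSucc dst src) (base T) (base (Function.update T dst (encodeNat (bitsToNat (T src) + 1)))) (72 * (n + 1)) := by
  set xs := T src
  have h1 : Runs (copy (Sum.inr src) (ra .x) (ra .t) (ra .u)) (base T)
      (nst (AReg.file xs [] [] [] [] [] [] []) mClean eClean T) (10 * xs.length + 3) :=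
    (runs_copy (by simp [ra]) (by simp [ra]) (by simp [ra]) (by simp [ra]) (by simp [ra]) (by simp [ra]) (base T)
      rfl rfl).of_eq (by simp [xs]) (by simp [xs])
  have h2 : Runs (push (ra .y) true) (nst (AReg.file xs [] [] [] [] [] [] []) mClean eClean T)
      (nst (AReg.file xs [true] [] [] [] [] [] []) mClean eClean T) 1 := Runs.push' (by simp)
  have h3 : Runs (liftA add) (nst (AReg.file xs [true] [] [] [] [] [] []) mClean eClean T)
      (nst (AReg.file (addRes xs [true]) [true] [] [] [] [] [] []) mClean eClean T) (13 * (xs.length + 1) + 12) :=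
    (runs_add xs [true] [] [] []).liftA _ _ _
  have h4 : Runs (liftA normalize) (nst (AReg.file (addRes xs [true]) [true] [] [] [] [] [] []) mClean eClean T)
      (nst (AReg.file (norm (addRes xs [true])) [true] [] [] [] [] [] []) mClean eClean T)
      (9 * (addRes xs [true]).length + 5) :=
    (runs_normalize (addRes xs [true]) [true] [] [] [] []).liftA _ _ _
  have h5 : Runs (clear (ra .y)) (nst (AReg.file (norm (addRes xs [true])) [true] [] [] [] [] [] []) mClean eClean T)
      (nst (AReg.file (norm (addRes xs [true])) [] [] [] [] [] [] []) mClean eClean T) (2 * 1 + 1) :=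
    (runs_clear (ra .y) _).of_eq (by simp) (by simp)
  have h6 : Runs (clear (Sum.inr dst)) (nst (AReg.file (norm (addRes xs [true])) [] [] [] [] [] [] []) mClean eClean T)
      (nst (AReg.file (norm (addRes xs [true])) [] [] [] [] [] [] []) mClean eClean (Function.update T dst []))
      (2 * (T dst).length + 1) :=
    (runs_clear (Sum.inr dst) _).of_eq (by simp) (by simp)
  have h7 : Runs (move (ra .x) (Sum.inr dst) (ra .s))
      (nst (AReg.file (norm (addRes xs [true])) [] [] [] [] [] [] []) mClean eClean (Function.update T dst []))
      (base (Function.update T dst (norm (addRes xs [true])))) (6 * (norm (addRes xs [true])).length + 2) :=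
    (runs_move (by simp [ra]) (by simp [ra]) (by simp [ra]) _ rfl).of_eq (by simp) (by simp)
  have hl := length_addRes_le_max xs [true]
  have hl' := length_norm_le (addRes xs [true])
  have hmax : max xs.length [true].length ≤ n + 1 := max_le (by omega) (by simp)
  refine (h1.seq (h2.seq (h3.seq (h4.seq (h5.seq (h6.seq h7)))))).of_eq ?_ (by omega)
  rw [norm_eq_encodeNat, bitsToNat_addRes]
  simp

/-! ### Subtraction and comparisons -/

/-- `nSub dst a b`: `dst :=` numeral of `a - b`, for `b ≤ a` (`dst` may be `a` or `b`).
[Knuth 1998, §4.3.1, Algorithm S] [folklore] -/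
def nSub (dst a b : β) : Com (EReg ⊕ β) :=
  copy (Sum.inr a) (ra .x) (ra .t) (ra .u) ;; copy (Sum.inr b) (ra .y) (ra .t) (ra .u) ;;
  liftA sub ;; liftA normalize ;; clear (ra .y) ;; clear (ra .g) ;; clear (Sum.inr dst) ;;
  move (ra .x) (Sum.inr dst) (ra .s)

/-- **Simulation of `nSub`** (no borrow), in `71 (n + 1)` steps when `|a|, |b| ≤ n`,
`|dst| ≤ n + 1`. [Knuth 1998, §4.3.1, Algorithm S] [folklore] -/
theorem runs_nSub (dst a b : β) (T : Regs β) {n : ℕ} (ha : (T a).length ≤ n) (hb : (T b).length ≤ n)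
    (hd : (T dst).length ≤ n + 1) (hle : bitsToNat (T b) ≤ bitsToNat (T a)) :
    Runs (nSub dst a b) (base T) (base (Function.update T dst (encodeNat (bitsToNat (T a) - bitsToNat (T b)))))
      (71 * (n + 1)) := by
  set xs := T a
  set ys := T b
  have hbw : subBorrow xs ys = false := by rw [subBorrow_iff]; simpa using hle
  have h1 : Runs (copy (Sum.inr a) (ra .x) (ra .t) (ra .u)) (base T)
      (nst (AReg.file xs [] [] [] [] [] [] []) mClean eClean T) (10 * xs.length + 3) :=
    (runs_copy (by simp [ra]) (by simp [ra]) (by simp [ra]) (by simp [ra]) (by simp [ra]) (by simp [ra]) (base T)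
      rfl rfl).of_eq (by simp [xs]) (by simp [xs])
  have h2 : Runs (copy (Sum.inr b) (ra .y) (ra .t) (ra .u)) (nst (AReg.file xs [] [] [] [] [] [] []) mClean eClean T)
      (nst (AReg.file xs ys [] [] [] [] [] []) mClean eClean T) (10 * ys.length + 3) :=
    (runs_copy (by simp [ra]) (by simp [ra]) (by simp [ra]) (by simp [ra]) (by simp [ra]) (by simp [ra]) _
      rfl rfl).of_eq (by simp [ys]) (by simp [ys])
  have h3 : Runs (liftA sub) (nst (AReg.file xs ys [] [] [] [] [] []) mClean eClean T)
      (nst (AReg.file (subRes xs ys) ys [] [] [] [] [] [true]) mClean eClean T) (16 * (xs.length + ys.length) + 12) := by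
    simpa [hbw] using (runs_sub xs ys []).liftA mClean eClean T
  have h4 : Runs (liftA normalize) (nst (AReg.file (subRes xs ys) ys [] [] [] [] [] [true]) mClean eClean T)
      (nst (AReg.file (norm (subRes xs ys)) ys [] [] [] [] [] [true]) mClean eClean T) (9 * (subRes xs ys).length + 5) :=
    (runs_normalize (subRes xs ys) ys [] [] [] [true]).liftA _ _ _
  have h5 : Runs (clear (ra .y)) (nst (AReg.file (norm (subRes xs ys)) ys [] [] [] [] [] [true]) mClean eClean T)
      (nst (AReg.file (norm (subRes xs ys)) [] [] [] [] [] [] [true]) mClean eClean T) (2 * ys.length + 1) :=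
    (runs_clear (ra .y) _).of_eq (by simp) (by simp)
  have h6 : Runs (clear (ra .g)) (nst (AReg.file (norm (subRes xs ys)) [] [] [] [] [] [] [true]) mClean eClean T)
      (nst (AReg.file (norm (subRes xs ys)) [] [] [] [] [] [] []) mClean eClean T) (2 * 1 + 1) :=
    (runs_clear (ra .g) _).of_eq (by simp) (by simp)
  have h7 : Runs (clear (Sum.inr dst)) (nst (AReg.file (norm (subRes xs ys)) [] [] [] [] [] [] []) mClean eClean T)
      (nst (AReg.file (norm (subRes xs ys)) [] [] [] [] [] [] []) mClean eClean (Function.update T dst []))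
      (2 * (T dst).length + 1) :=
    (runs_clear (Sum.inr dst) _).of_eq (by simp) (by simp)
  have h8 : Runs (move (ra .x) (Sum.inr dst) (ra .s))
      (nst (AReg.file (norm (subRes xs ys)) [] [] [] [] [] [] []) mClean eClean (Function.update T dst []))
      (base (Function.update T dst (norm (subRes xs ys)))) (6 * (norm (subRes xs ys)).length + 2) :=
    (runs_move (by simp [ra]) (by simp [ra]) (by simp [ra]) _ rfl).of_eq (by simp) (by simp)
  have hl := length_subRes xs ys
  have hl' := length_norm_le (subRes xs ys)
  refine (h1.seq (h2.seq (h3.seq (h4.seq (h5.seq (h6.seq (h7.seq h8))))))).of_eq ?_ (by omega)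
  rw [norm_eq_encodeNat, bitsToNat_subRes xs ys hle]

/-- `nCmp F a b`: set the flag `F` to `[b ≤ a]` (as numbers; `F` must be empty). [Knuth 1998,
§4.3.1 (comparison by trial subtraction)] [folklore] -/
def nCmp (F a b : β) : Com (EReg ⊕ β) :=
  copy (Sum.inr a) (ra .x) (ra .t) (ra .u) ;; copy (Sum.inr b) (ra .y) (ra .t) (ra .u) ;;
  liftA sub ;; move (ra .g) (Sum.inr F) (ra .s) ;; clear (ra .x) ;; clear (ra .y)

/-- **Simulation of `nCmp`**, in `56 (n + 1)` steps when `|a|, |b| ≤ n`. [folklore] -/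
theorem runs_nCmp (F a b : β) (T : Regs β) {n : ℕ} (ha : (T a).length ≤ n) (hb : (T b).length ≤ n)
    (hF : T F = []) :
    Runs (nCmp F a b) (base T) (base (Function.update T F (flag (decide (bitsToNat (T b) ≤ bitsToNat (T a))))))
      (56 * (n + 1)) := by
  set xs := T a
  set ys := T b
  set x' := (bif subBorrow xs ys then xs else subRes xs ys) with hx'
  have hxl : x'.length = xs.length := by rw [hx']; cases subBorrow xs ys <;> simp [length_subRes]
  have hfl : flag (!subBorrow xs ys) = flag (decide (bitsToNat ys ≤ bitsToNat xs)) := by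
    rw [subBorrow_iff]
    by_cases h : bitsToNat xs < bitsToNat ys
    · simp [h, not_le.mpr h]
    · simp [h, not_lt.mp h]
  have h1 : Runs (copy (Sum.inr a) (ra .x) (ra .t) (ra .u)) (base T)
      (nst (AReg.file xs [] [] [] [] [] [] []) mClean eClean T) (10 * xs.length + 3) :=
    (runs_copy (by simp [ra]) (by simp [ra]) (by simp [ra]) (by simp [ra]) (by simp [ra]) (by simp [ra]) (base T)
      rfl rfl).of_eq (by simp [xs]) (by simp [xs])
  have h2 : Runs (copy (Sum.inr b) (ra .y) (ra .t) (ra .u)) (nst (AReg.file xs [] [] [] [] [] [] []) mClean eClean T)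
      (nst (AReg.file xs ys [] [] [] [] [] []) mClean eClean T) (10 * ys.length + 3) :=
    (runs_copy (by simp [ra]) (by simp [ra]) (by simp [ra]) (by simp [ra]) (by simp [ra]) (by simp [ra]) _
      rfl rfl).of_eq (by simp [ys]) (by simp [ys])
  have h3 : Runs (liftA sub) (nst (AReg.file xs ys [] [] [] [] [] []) mClean eClean T)
      (nst (AReg.file x' ys [] [] [] [] [] (flag (!subBorrow xs ys))) mClean eClean T)
      (16 * (xs.length + ys.length) + 12) :=
    (runs_sub xs ys []).liftA mClean eClean T
  have h4 : Runs (move (ra .g) (Sum.inr F) (ra .s))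
      (nst (AReg.file x' ys [] [] [] [] [] (flag (!subBorrow xs ys))) mClean eClean T)
      (nst (AReg.file x' ys [] [] [] [] [] []) mClean eClean (Function.update T F (flag (!subBorrow xs ys))))
      (6 * 1 + 2) :=
    (runs_move (by simp [ra]) (by simp [ra]) (by simp [ra]) _ rfl).of_eq (by simp [hF])
      (by cases subBorrow xs ys <;> simp)
  have h5 : Runs (clear (ra .x))
      (nst (AReg.file x' ys [] [] [] [] [] []) mClean eClean (Function.update T F (flag (!subBorrow xs ys))))
      (nst (AReg.file [] ys [] [] [] [] [] []) mClean eClean (Function.update T F (flag (!subBorrow xs ys))))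
      (2 * xs.length + 1) :=
    (runs_clear (ra .x) _).of_eq (by simp) (by simp [hxl])
  have h6 : Runs (clear (ra .y))
      (nst (AReg.file [] ys [] [] [] [] [] []) mClean eClean (Function.update T F (flag (!subBorrow xs ys))))
      (base (Function.update T F (flag (!subBorrow xs ys)))) (2 * ys.length + 1) :=
    (runs_clear (ra .y) _).of_eq (by simp) (by simp)
  refine (h1.seq (h2.seq (h3.seq (h4.seq (h5.seq h6))))).of_eq (by rw [hfl]) (by omega)

/-- `nEq F a b G`: set the flag `F` to `[a = b]` (as numbers; flags `F`, `G` must be empty, `G`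
is scratch). [folklore] -/
def nEq (F a b G : β) : Com (EReg ⊕ β) :=
  nCmp F a b ;; nCmp G b a ;; pop (Sum.inr G) skip skip (clear (Sum.inr F))

/-- **Simulation of `nEq`**, in `117 (n + 1)` steps when `|a|, |b| ≤ n`. [folklore] -/
theorem runs_nEq {F a b G : β} (hFG : F ≠ G) (hFa : F ≠ a) (hFb : F ≠ b)
    (T : Regs β) {n : ℕ} (ha : (T a).length ≤ n) (hb : (T b).length ≤ n) (hF : T F = []) (hG : T G = []) :
    Runs (nEq F a b G) (base T) (base (Function.update T F (flag (decide (bitsToNat (T a) = bitsToNat (T b))))))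
      (117 * (n + 1)) := by
  set c₁ := decide (bitsToNat (T b) ≤ bitsToNat (T a)) with hc₁def
  set c₂ := decide (bitsToNat (T a) ≤ bitsToNat (T b)) with hc₂def
  have h1 : Runs (nCmp F a b) (base T) (base (Function.update T F (flag c₁))) (56 * (n + 1)) := runs_nCmp F a b T ha hb hF
  have h2 : Runs (nCmp G b a) (base (Function.update T F (flag c₁)))
      (base (Function.update (Function.update T F (flag c₁)) G (flag c₂))) (56 * (n + 1)) := by
    have := runs_nCmp G b a (Function.update T F (flag c₁)) (n := n) (by simp [Function.update_of_ne hFb.symm, hb])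
      (by simp [Function.update_of_ne hFa.symm, ha]) (by simp [Function.update_of_ne hFG.symm, hG])
    refine this.of_eq ?_ le_rfl
    simp [Function.update_of_ne hFa.symm, Function.update_of_ne hFb.symm, hc₂def]
  have h3 : Runs (pop (Sum.inr G) skip skip (clear (Sum.inr F)))
      (base (Function.update (Function.update T F (flag c₁)) G (flag c₂)))
      (base (Function.update T F (flag (decide (bitsToNat (T a) = bitsToNat (T b)))))) 5 := by
    by_cases hab : bitsToNat (T a) ≤ bitsToNat (T b)
    · have hc₂ : c₂ = true := by simp [hc₂def, hab]
      have hres : decide (bitsToNat (T a) = bitsToNat (T b)) = c₁ := by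
        by_cases hba : bitsToNat (T b) ≤ bitsToNat (T a)
        · simp [hc₁def, le_antisymm hab hba]
        · have : bitsToNat (T a) ≠ bitsToNat (T b) := fun h => hba (h ▸ le_rfl)
          simp [hc₁def, hba, this]
      rw [hres, hc₂]
      refine (Runs.pop_true' _ _ (w := []) (by simp) (by simp)
        (Runs.skip (base (Function.update (Function.update T F (flag c₁)) G [])))).of_eq ?_ (by norm_num)
      congr 1; (funext i; simp only [Function.update_apply]; split_ifs <;> simp_all)
    · have hc₂ : c₂ = false := by simp [hc₂def, hab]
      have hres : decide (bitsToNat (T a) = bitsToNat (T b)) = false := by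
        have : bitsToNat (T a) ≠ bitsToNat (T b) := fun h => hab h.le
        simp [this]
      rw [hres, hc₂, flag_false]
      have hc' : Runs (clear (Sum.inr F)) (base (Function.update (Function.update T F (flag c₁)) G []))
          (base (Function.update (Function.update (Function.update T F (flag c₁)) G []) F [])) (2 * (flag c₁).length + 1) :=
        (runs_clear (Sum.inr F) _).of_eq (by simp) (by simp [Function.update_of_ne hFG])
      refine (Runs.pop_nil _ _ (by simp) hc').of_eq ?_ ?_
      · congr 1; (funext i; simp only [Function.update_apply]; split_ifs <;> simp_all)
      · have := length_flag_le c₁; omega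
  exact (h1.seq (h2.seq h3)).of_eq rfl (by omega)

/-- `nIsT r F`: set the flag `F` to `[r = [true]]`, consuming `r` (`F` must be empty). [folklore] -/
def nIsT (r F : β) : Com (EReg ⊕ β) :=
  pop (Sum.inr r) (pop (Sum.inr r) (clear (Sum.inr r)) (clear (Sum.inr r)) (push (Sum.inr F) true))
    (clear (Sum.inr r)) skip

/-- Effect of `nIsT`, in `2|r| + 5` steps. [folklore] -/
theorem runs_nIsT {r F : β} (hrF : r ≠ F) (T : Regs β) (hF : T F = []) :
    Runs (nIsT r F) (base T)
      (base (Function.update (Function.update T r []) F (flag (decide (T r = [true]))))) (2 * (T r).length + 5) := by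
  unfold nIsT
  rcases hr : T r with _ | ⟨b, w⟩
  · have e : Function.update (Function.update T r []) F (flag (decide (([] : List Bool) = [true]))) = T := by
      (funext i; simp only [Function.update_apply]; split_ifs <;> simp_all)
    rw [e]
    exact (Runs.pop_nil _ _ (by simp [hr]) (Runs.skip _)).of_eq rfl (by simp)
  · have eclr : Function.update (Function.update T r []) F [] = Function.update T r [] := by
      (funext i; simp only [Function.update_apply]; split_ifs <;> simp_all)
    have hc : ∀ v : List Bool, Runs (clear (Sum.inr r)) (base (Function.update T r v)) (base (Function.update T r []))
        (2 * v.length + 1) :=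
      fun v => (runs_clear (Sum.inr r) _).of_eq (by simp) (by simp)
    cases b
    · -- `r = false :: w`
      refine (Runs.pop_false' _ _ (w := w) (by simp [hr]) (by simp) (hc w)).of_eq ?_ (by simp only [List.length_cons]; omega)
      simp [eclr]
    · rcases w with _ | ⟨c, w'⟩
      · -- `r = [true]`
        have hp : Runs (push (Sum.inr F) true) (base (Function.update T r []))
            (base (Function.update (Function.update T r []) F [true])) 1 :=
          Runs.push' (by simp [Function.update_of_ne hrF.symm, hF])
        refine (Runs.pop_true' _ _ (w := []) (by simp [hr]) (by simp) (Runs.pop_nil _ _ (by simp) hp)).of_eq ?_ (by simp)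
        simp
      · -- `r = true :: c :: w'`
        have hinner : Runs (pop (Sum.inr r) (clear (Sum.inr r)) (clear (Sum.inr r)) (push (Sum.inr F) true))
            (base (Function.update T r (c :: w'))) (base (Function.update T r [])) ((2 * w'.length + 1) + 2) := by
          cases c
          · exact Runs.pop_false' _ _ (w := w') (by simp) (by simp) (hc w')
          · exact Runs.pop_true' _ _ (w := w') (by simp) (by simp) (hc w')
        refine (Runs.pop_true' _ _ (w := c :: w') (by simp [hr]) (by simp) hinner).of_eq ?_ (by simp; omega)
        simp [eclr]

/-- `nNot F`: negate the flag `F`. [folklore] -/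
def nNot (F : β) : Com (EReg ⊕ β) :=
  pop (Sum.inr F) (clear (Sum.inr F)) (clear (Sum.inr F)) (push (Sum.inr F) true)

/-- Effect of `nNot` on a flag, in `4` steps. [folklore] -/
theorem runs_nNot (F : β) (T : Regs β) (c : Bool) (hF : T F = flag c) :
    Runs (nNot F) (base T) (base (Function.update T F (flag !c))) 4 := by
  unfold nNot
  cases c
  · refine (Runs.pop_nil _ _ (by simp [hF]) (Runs.push' rfl)).of_eq (by simp [hF]) (by norm_num)
  · refine (Runs.pop_true' _ _ (w := []) (by simp [hF]) rfl ((runs_clear (Sum.inr F) _).of_eq rfl le_rfl)).of_eq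
      (by simp) (by simp)

/-! ### Multiplication and division -/

/-- `nMul dst a b`: `dst :=` numeral of `a · b`. [Knuth 1998, §4.3.1, Algorithm M] [folklore] -/
def nMul (dst a b : β) : Com (EReg ⊕ β) :=
  copy (Sum.inr a) (rm .p) (ra .t) (ra .u) ;; copy (Sum.inr b) (rm .q) (ra .t) (ra .u) ;; liftM mul ;;
  move (rm .r) (ra .x) (ra .s) ;; liftA normalize ;; clear (Sum.inr dst) ;; move (ra .x) (Sum.inr dst) (ra .s)

/-- **Simulation of `nMul`**, in `270 (n + 1)²` steps when `|a|, |b| ≤ n`, `|dst| ≤ 2n + 2`.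
[Knuth 1998, §4.3.1, Algorithm M] [folklore] -/
theorem runs_nMul (dst a b : β) (T : Regs β) {n : ℕ} (ha : (T a).length ≤ n) (hb : (T b).length ≤ n)
    (hd : (T dst).length ≤ 2 * n + 2) :
    Runs (nMul dst a b) (base T) (base (Function.update T dst (encodeNat (bitsToNat (T a) * bitsToNat (T b)))))
      (270 * (n + 1) ^ 2) := by
  set xs := T a
  set ys := T b
  have h1 : Runs (copy (Sum.inr a) (rm .p) (ra .t) (ra .u)) (base T)
      (nst aClean (MOwn.file xs [] [] []) eClean T) (10 * xs.length + 3) :=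
    (runs_copy (by simp [rm]) (by simp [ra]) (by simp [ra]) (by simp [ra, rm]) (by simp [ra, rm]) (by simp [ra])
      (base T) rfl rfl).of_eq (by simp [xs]) (by simp [xs])
  have h2 : Runs (copy (Sum.inr b) (rm .q) (ra .t) (ra .u)) (nst aClean (MOwn.file xs [] [] []) eClean T)
      (nst aClean (MOwn.file xs ys [] []) eClean T) (10 * ys.length + 3) :=
    (runs_copy (by simp [rm]) (by simp [ra]) (by simp [ra]) (by simp [ra, rm]) (by simp [ra, rm]) (by simp [ra])
      _ rfl rfl).of_eq (by simp [ys]) (by simp [ys])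
  have h3 : Runs (liftM mul) (nst aClean (MOwn.file xs ys [] []) eClean T)
      (nst aClean (MOwn.file [] [] (mulRes xs ys) []) eClean T) (50 * (xs.length + ys.length + 1) ^ 2) :=
    (runs_mul xs ys [] [] [] []).liftM eClean T
  have h4 : Runs (move (rm .r) (ra .x) (ra .s)) (nst aClean (MOwn.file [] [] (mulRes xs ys) []) eClean T)
      (nst (AReg.file (mulRes xs ys) [] [] [] [] [] [] []) mClean eClean T) (6 * (mulRes xs ys).length + 2) :=
    (runs_move (by simp [ra, rm]) (by simp [ra, rm]) (by simp [ra]) _ rfl).of_eq (by simp) (by simp)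
  have h5 : Runs (liftA normalize) (nst (AReg.file (mulRes xs ys) [] [] [] [] [] [] []) mClean eClean T)
      (nst (AReg.file (norm (mulRes xs ys)) [] [] [] [] [] [] []) mClean eClean T) (9 * (mulRes xs ys).length + 5) :=
    (runs_normalize (mulRes xs ys) [] [] [] [] []).liftA _ _ _
  have h6 : Runs (clear (Sum.inr dst)) (nst (AReg.file (norm (mulRes xs ys)) [] [] [] [] [] [] []) mClean eClean T)
      (nst (AReg.file (norm (mulRes xs ys)) [] [] [] [] [] [] []) mClean eClean (Function.update T dst []))
      (2 * (T dst).length + 1) :=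
    (runs_clear (Sum.inr dst) _).of_eq (by simp) (by simp)
  have h7 : Runs (move (ra .x) (Sum.inr dst) (ra .s))
      (nst (AReg.file (norm (mulRes xs ys)) [] [] [] [] [] [] []) mClean eClean (Function.update T dst []))
      (base (Function.update T dst (norm (mulRes xs ys)))) (6 * (norm (mulRes xs ys)).length + 2) :=
    (runs_move (by simp [ra]) (by simp [ra]) (by simp [ra]) _ rfl).of_eq (by simp) (by simp)
  have hl := length_mulRes_le xs ys
  have hl' := length_norm_le (mulRes xs ys)
  refine (h1.seq (h2.seq (h3.seq (h4.seq (h5.seq (h6.seq h7)))))).of_eq ?_ ?_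
  · rw [norm_eq_encodeNat, bitsToNat_mulRes]
  · have hsq : (xs.length + ys.length + 1) ^ 2 ≤ 4 * (n + 1) ^ 2 := by nlinarith
    nlinarith

/-- `nDivMod qd rd a b`: `qd :=` numeral of `a / b`, `rd :=` numeral of `a % b` (`b > 0`).
[Knuth 1998, §4.3.1, Algorithm D] [folklore] -/
def nDivMod (qd rd a b : β) : Com (EReg ⊕ β) :=
  clear (Sum.inr qd) ;; clear (Sum.inr rd) ;;
  copy (Sum.inr a) (rm .p) (ra .t) (ra .u) ;; copy (Sum.inr b) (rm .q) (ra .t) (ra .u) ;; liftM divMod ;;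
  clear (rm .q) ;; move (rm .r) (ra .x) (ra .s) ;; liftA normalize ;; move (ra .x) (Sum.inr qd) (ra .s) ;;
  move (rm .w) (ra .x) (ra .s) ;; liftA normalize ;; move (ra .x) (Sum.inr rd) (ra .s)

/-- **Simulation of `nDivMod`**, in `350 (n + 1)²` steps when `|a|, |b|, |qd|, |rd| ≤ n`.
[Knuth 1998, §4.3.1, Algorithm D] [folklore] -/
theorem runs_nDivMod {qd rd a b : β} (hqr : qd ≠ rd) (hqa : qd ≠ a) (hqb : qd ≠ b) (hra : rd ≠ a) (hrb : rd ≠ b)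
    (T : Regs β) {n : ℕ} (ha : (T a).length ≤ n) (hb : (T b).length ≤ n) (hq : (T qd).length ≤ n)
    (hr : (T rd).length ≤ n) (hpos : 0 < bitsToNat (T b)) :
    Runs (nDivMod qd rd a b) (base T)
      (base (Function.update (Function.update T qd (encodeNat (bitsToNat (T a) / bitsToNat (T b)))) rd
        (encodeNat (bitsToNat (T a) % bitsToNat (T b))))) (350 * (n + 1) ^ 2) := by
  set xs := T a
  set ys := T b
  set T₁ := Function.update (Function.update T qd []) rd [] with hT₁
  have hT₁a : T₁ a = xs := by simp [T₁, Function.update_of_ne hqa.symm, Function.update_of_ne hra.symm, xs]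
  have hT₁b : T₁ b = ys := by simp [T₁, Function.update_of_ne hqb.symm, Function.update_of_ne hrb.symm, ys]
  have h0a : Runs (clear (Sum.inr qd)) (base T) (base (Function.update T qd [])) (2 * (T qd).length + 1) :=
    (runs_clear (Sum.inr qd) (base T)).of_eq (by simp) (by simp)
  have h0b : Runs (clear (Sum.inr rd)) (base (Function.update T qd [])) (base T₁) (2 * (T rd).length + 1) :=
    (runs_clear (Sum.inr rd) _).of_eq (by simp [T₁]) (by simp [Function.update_of_ne hqr.symm])
  have h1 : Runs (copy (Sum.inr a) (rm .p) (ra .t) (ra .u)) (base T₁)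
      (nst aClean (MOwn.file xs [] [] []) eClean T₁) (10 * xs.length + 3) :=
    (runs_copy (by simp [rm]) (by simp [ra]) (by simp [ra]) (by simp [ra, rm]) (by simp [ra, rm]) (by simp [ra])
      (base T₁) rfl rfl).of_eq (by simp [hT₁a]) (by simp [hT₁a])
  have h2 : Runs (copy (Sum.inr b) (rm .q) (ra .t) (ra .u)) (nst aClean (MOwn.file xs [] [] []) eClean T₁)
      (nst aClean (MOwn.file xs ys [] []) eClean T₁) (10 * ys.length + 3) :=
    (runs_copy (by simp [rm]) (by simp [ra]) (by simp [ra]) (by simp [ra, rm]) (by simp [ra, rm]) (by simp [ra])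
      _ rfl rfl).of_eq (by simp [hT₁b]) (by simp [hT₁b])
  have h3 : Runs (liftM divMod) (nst aClean (MOwn.file xs ys [] []) eClean T₁)
      (nst aClean (MOwn.file [] ys (divQ xs ys) (divR xs ys)) eClean T₁) (70 * (xs.length + ys.length + 1) ^ 2) :=
    (runs_divMod xs ys).liftM eClean T₁
  have h4 : Runs (clear (rm .q)) (nst aClean (MOwn.file [] ys (divQ xs ys) (divR xs ys)) eClean T₁)
      (nst aClean (MOwn.file [] [] (divQ xs ys) (divR xs ys)) eClean T₁) (2 * ys.length + 1) :=
    (runs_clear (rm .q) _).of_eq (by simp) (by simp)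
  have h5 : Runs (move (rm .r) (ra .x) (ra .s)) (nst aClean (MOwn.file [] [] (divQ xs ys) (divR xs ys)) eClean T₁)
      (nst (AReg.file (divQ xs ys) [] [] [] [] [] [] []) (MOwn.file [] [] [] (divR xs ys)) eClean T₁)
      (6 * (divQ xs ys).length + 2) :=
    (runs_move (by simp [ra, rm]) (by simp [ra, rm]) (by simp [ra]) _ rfl).of_eq (by simp) (by simp)
  have h6 : Runs (liftA normalize)
      (nst (AReg.file (divQ xs ys) [] [] [] [] [] [] []) (MOwn.file [] [] [] (divR xs ys)) eClean T₁)
      (nst (AReg.file (norm (divQ xs ys)) [] [] [] [] [] [] []) (MOwn.file [] [] [] (divR xs ys)) eClean T₁)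
      (9 * (divQ xs ys).length + 5) :=
    (runs_normalize (divQ xs ys) [] [] [] [] []).liftA _ _ _
  set T₂ := Function.update T₁ qd (norm (divQ xs ys)) with hT₂
  have h7 : Runs (move (ra .x) (Sum.inr qd) (ra .s))
      (nst (AReg.file (norm (divQ xs ys)) [] [] [] [] [] [] []) (MOwn.file [] [] [] (divR xs ys)) eClean T₁)
      (nst aClean (MOwn.file [] [] [] (divR xs ys)) eClean T₂) (6 * (norm (divQ xs ys)).length + 2) :=
    (runs_move (by simp [ra]) (by simp [ra]) (by simp [ra]) _ rfl).of_eq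
      (by simp [T₂, T₁, Function.update_of_ne hqr]) (by simp)
  have h8 : Runs (move (rm .w) (ra .x) (ra .s)) (nst aClean (MOwn.file [] [] [] (divR xs ys)) eClean T₂)
      (nst (AReg.file (divR xs ys) [] [] [] [] [] [] []) mClean eClean T₂) (6 * (divR xs ys).length + 2) :=
    (runs_move (by simp [ra, rm]) (by simp [ra, rm]) (by simp [ra]) _ rfl).of_eq (by simp) (by simp)
  have h9 : Runs (liftA normalize) (nst (AReg.file (divR xs ys) [] [] [] [] [] [] []) mClean eClean T₂)
      (nst (AReg.file (norm (divR xs ys)) [] [] [] [] [] [] []) mClean eClean T₂) (9 * (divR xs ys).length + 5) :=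
    (runs_normalize (divR xs ys) [] [] [] [] []).liftA _ _ _
  have h10 : Runs (move (ra .x) (Sum.inr rd) (ra .s))
      (nst (AReg.file (norm (divR xs ys)) [] [] [] [] [] [] []) mClean eClean T₂)
      (base (Function.update T₂ rd (norm (divR xs ys)))) (6 * (norm (divR xs ys)).length + 2) :=
    (runs_move (by simp [ra]) (by simp [ra]) (by simp [ra]) _ rfl).of_eq (by simp [T₂, T₁, Function.update_of_ne hqr.symm]) (by simp)
  have hlq := length_norm_le (divQ xs ys)
  have hlr := length_norm_le (divR xs ys)
  have hlq' := length_divQ xs ys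
  have hlr' := length_divR xs ys
  refine (h0a.seq (h0b.seq (h1.seq (h2.seq (h3.seq (h4.seq (h5.seq (h6.seq (h7.seq (h8.seq (h9.seq h10))))))))))).of_eq ?_ ?_
  · simp only [T₂, T₁, norm_eq_encodeNat, (bitsToNat_divMod xs ys hpos).1, (bitsToNat_divMod xs ys hpos).2]
    congr 1
    (funext i; simp only [Function.update_apply]; split_ifs <;> simp_all)
  · have hsq : (xs.length + ys.length + 1) ^ 2 ≤ 4 * (n + 1) ^ 2 := by nlinarith
    nlinarith

/-! ### Modular multiplication and exponentiation -/

/-- `nModMul dst src m`: `dst :=` numeral of `dst · src mod m` (`m > 0`).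
[Knuth 1998, §4.3.1 with §4.6.3] [folklore] -/
def nModMul (dst src m : β) : Com (EReg ⊕ β) :=
  move (Sum.inr dst) (re .a) (ra .s) ;; copy (Sum.inr src) (re .b) (ra .t) (ra .u) ;;
  copy (Sum.inr m) (re .m) (ra .t) (ra .u) ;; liftE (mulMod .a .b) ;;
  move (re .a) (Sum.inr dst) (ra .s) ;; clear (re .b) ;; clear (re .m)

/-- **Simulation of `nModMul`**, in `940 (n + 1)²` steps when `|dst|, |src|, |m| ≤ n`.
[Knuth 1998, §4.6.3] [folklore] -/
theorem runs_nModMul {dst src m : β} (hds : dst ≠ src) (hdm : dst ≠ m) (T : Regs β) {n : ℕ}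
    (hd : (T dst).length ≤ n) (hs : (T src).length ≤ n) (hm : (T m).length ≤ n) (hpos : 0 < bitsToNat (T m)) :
    Runs (nModMul dst src m) (base T)
      (base (Function.update T dst (encodeNat (bitsToNat (T dst) * bitsToNat (T src) % bitsToNat (T m)))))
      (940 * (n + 1) ^ 2) := by
  set as := T dst
  set bs := T src
  set ms := T m
  set T₁ := Function.update T dst [] with hT₁
  have hT₁s : T₁ src = bs := by simp [T₁, Function.update_of_ne hds.symm, bs]
  have hT₁m : T₁ m = ms := by simp [T₁, Function.update_of_ne hdm.symm, ms]
  have h1 : Runs (move (Sum.inr dst) (re .a) (ra .s)) (base T)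
      (nst aClean mClean (EOwn.file [] [] as []) T₁) (6 * as.length + 2) :=
    (runs_move (by simp [re]) (by simp [ra]) (by simp [ra, re]) (base T) rfl).of_eq (by simp [as, T₁]) (by simp [as])
  have h2 : Runs (copy (Sum.inr src) (re .b) (ra .t) (ra .u)) (nst aClean mClean (EOwn.file [] [] as []) T₁)
      (nst aClean mClean (EOwn.file bs [] as []) T₁) (10 * bs.length + 3) :=
    (runs_copy (by simp [re]) (by simp [ra]) (by simp [ra]) (by simp [ra, re]) (by simp [ra, re]) (by simp [ra])
      _ rfl rfl).of_eq (by simp [hT₁s]) (by simp [hT₁s])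
  have h3 : Runs (copy (Sum.inr m) (re .m) (ra .t) (ra .u)) (nst aClean mClean (EOwn.file bs [] as []) T₁)
      (nst aClean mClean (EOwn.file bs [] as ms) T₁) (10 * ms.length + 3) :=
    (runs_copy (by simp [re]) (by simp [ra]) (by simp [ra]) (by simp [ra, re]) (by simp [ra, re]) (by simp [ra])
      _ rfl rfl).of_eq (by simp [hT₁m]) (by simp [hT₁m])
  have h4 : Runs (liftE (mulMod .a .b)) (nst aClean mClean (EOwn.file bs [] as ms) T₁)
      (nst aClean mClean (EOwn.file bs [] (encodeNat (bitsToNat as * bitsToNat bs % bitsToNat ms)) ms) T₁)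
      (900 * (n + 1) ^ 2) :=
    (runs_mulMod_ab bs [] as ms n hs hd hm hpos).liftE T₁
  set res := encodeNat (bitsToNat as * bitsToNat bs % bitsToNat ms) with hres
  have hresl : res.length ≤ n := (length_encodeNat_mod_le _ ms hpos).trans hm
  have h5 : Runs (move (re .a) (Sum.inr dst) (ra .s)) (nst aClean mClean (EOwn.file bs [] res ms) T₁)
      (nst aClean mClean (EOwn.file bs [] [] ms) (Function.update T dst res)) (6 * res.length + 2) :=
    (runs_move (by simp [re]) (by simp [ra, re]) (by simp [ra]) _ rfl).of_eq (by simp [T₁]) (by simp)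
  have h6 : Runs (clear (re .b)) (nst aClean mClean (EOwn.file bs [] [] ms) (Function.update T dst res))
      (nst aClean mClean (EOwn.file [] [] [] ms) (Function.update T dst res)) (2 * bs.length + 1) :=
    (runs_clear (re .b) _).of_eq (by simp) (by simp)
  have h7 : Runs (clear (re .m)) (nst aClean mClean (EOwn.file [] [] [] ms) (Function.update T dst res))
      (base (Function.update T dst res)) (2 * ms.length + 1) :=
    (runs_clear (re .m) _).of_eq (by simp) (by simp)
  refine (h1.seq (h2.seq (h3.seq (h4.seq (h5.seq (h6.seq h7)))))).of_eq rfl ?_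
  nlinarith

/-- `nPowMod dst b e m`: `dst :=` numeral of `b ^ e mod m` (`m > 1`). [Knuth 1998, §4.6.3,
Algorithm A] [folklore] -/
def nPowMod (dst b e m : β) : Com (EReg ⊕ β) :=
  clear (Sum.inr dst) ;; copy (Sum.inr b) (re .b) (ra .t) (ra .u) ;; copy (Sum.inr e) (re .e) (ra .t) (ra .u) ;;
  copy (Sum.inr m) (re .m) (ra .t) (ra .u) ;; liftE powMod ;;
  move (re .a) (Sum.inr dst) (ra .s) ;; clear (re .b) ;; clear (re .m)

/-- **Simulation of `nPowMod`**, in `1900 (n + 1)³` steps when `|dst|, |b|, |e|, |m| ≤ n`.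
[Knuth 1998, §4.6.3, Algorithm A] [folklore] -/
theorem runs_nPowMod {dst b e m : β} (hdb : dst ≠ b) (hde : dst ≠ e) (hdm : dst ≠ m) (T : Regs β) {n : ℕ}
    (hd : (T dst).length ≤ n) (hb : (T b).length ≤ n) (he : (T e).length ≤ n) (hm : (T m).length ≤ n)
    (hm1 : 1 < bitsToNat (T m)) :
    Runs (nPowMod dst b e m) (base T)
      (base (Function.update T dst (encodeNat (bitsToNat (T b) ^ bitsToNat (T e) % bitsToNat (T m)))))
      (1900 * (n + 1) ^ 3) := by
  set bs := T b
  set es := T e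
  set ms := T m
  have hn : 1 ≤ n := by
    rcases Nat.eq_zero_or_pos n with rfl | h
    · have : ms = [] := List.eq_nil_of_length_eq_zero (Nat.le_zero.1 hm)
      simp [this] at hm1
    · exact h
  set T₁ := Function.update T dst [] with hT₁
  have hT₁b : T₁ b = bs := by simp [T₁, Function.update_of_ne hdb.symm, bs]
  have hT₁e : T₁ e = es := by simp [T₁, Function.update_of_ne hde.symm, es]
  have hT₁m : T₁ m = ms := by simp [T₁, Function.update_of_ne hdm.symm, ms]
  have h0 : Runs (clear (Sum.inr dst)) (base T) (base T₁) (2 * (T dst).length + 1) :=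
    (runs_clear (Sum.inr dst) _).of_eq (by simp [T₁]) (by simp)
  have h1 : Runs (copy (Sum.inr b) (re .b) (ra .t) (ra .u)) (base T₁)
      (nst aClean mClean (EOwn.file bs [] [] []) T₁) (10 * bs.length + 3) :=
    (runs_copy (by simp [re]) (by simp [ra]) (by simp [ra]) (by simp [ra, re]) (by simp [ra, re]) (by simp [ra])
      (base T₁) rfl rfl).of_eq (by simp [hT₁b]) (by simp [hT₁b])
  have h2 : Runs (copy (Sum.inr e) (re .e) (ra .t) (ra .u)) (nst aClean mClean (EOwn.file bs [] [] []) T₁)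
      (nst aClean mClean (EOwn.file bs es [] []) T₁) (10 * es.length + 3) :=
    (runs_copy (by simp [re]) (by simp [ra]) (by simp [ra]) (by simp [ra, re]) (by simp [ra, re]) (by simp [ra])
      _ rfl rfl).of_eq (by simp [hT₁e]) (by simp [hT₁e])
  have h3 : Runs (copy (Sum.inr m) (re .m) (ra .t) (ra .u)) (nst aClean mClean (EOwn.file bs es [] []) T₁)
      (nst aClean mClean (EOwn.file bs es [] ms) T₁) (10 * ms.length + 3) :=
    (runs_copy (by simp [re]) (by simp [ra]) (by simp [ra]) (by simp [ra, re]) (by simp [ra, re]) (by simp [ra])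
      _ rfl rfl).of_eq (by simp [hT₁m]) (by simp [hT₁m])
  set junk := (peL (bitsToNat ms) es [true] bs).2 with hjunk
  set res := encodeNat (bitsToNat bs ^ bitsToNat es % bitsToNat ms) with hres
  have h4 : Runs (liftE powMod) (nst aClean mClean (EOwn.file bs es [] ms) T₁)
      (nst aClean mClean (EOwn.file junk [] res ms) T₁) (es.length * (1800 * (n + 1) ^ 2 + 2) + 2) :=
    (runs_powMod ms hm1 n hn hm es bs hb).liftE T₁
  have hresl : res.length ≤ n := (length_encodeNat_mod_le _ ms (by omega)).trans hm
  have hjunkl : junk.length ≤ n := (length_peL_le ms (by omega) es [true] bs n (by simp; omega) hb hm).2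
  have h5 : Runs (move (re .a) (Sum.inr dst) (ra .s)) (nst aClean mClean (EOwn.file junk [] res ms) T₁)
      (nst aClean mClean (EOwn.file junk [] [] ms) (Function.update T dst res)) (6 * res.length + 2) :=
    (runs_move (by simp [re]) (by simp [ra, re]) (by simp [ra]) _ rfl).of_eq (by simp [T₁]) (by simp)
  have h6 : Runs (clear (re .b)) (nst aClean mClean (EOwn.file junk [] [] ms) (Function.update T dst res))
      (nst aClean mClean (EOwn.file [] [] [] ms) (Function.update T dst res)) (2 * junk.length + 1) :=
    (runs_clear (re .b) _).of_eq (by simp) (by simp)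
  have h7 : Runs (clear (re .m)) (nst aClean mClean (EOwn.file [] [] [] ms) (Function.update T dst res))
      (base (Function.update T dst res)) (2 * ms.length + 1) :=
    (runs_clear (re .m) _).of_eq (by simp) (by simp)
  refine (h0.seq (h1.seq (h2.seq (h3.seq (h4.seq (h5.seq (h6.seq h7))))))).of_eq rfl ?_
  have h' : es.length * (1800 * (n + 1) ^ 2 + 2) ≤ n * (1800 * (n + 1) ^ 2 + 2) := Nat.mul_le_mul_right _ he
  nlinarith

/-! ### Pairs of bit strings -/

/-- The loop of `nUnpair`: read the source two bits at a time. [Arora–Barak 2009, §0.1] [folklore] -/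
def unpairLoop (src snd : β) : Com (EReg ⊕ β) :=
  loop (Sum.inr src)
    (pop (Sum.inr src) (push (ra .s) true) (clear (Sum.inr src)) skip)
    (pop (Sum.inr src) (move (Sum.inr src) (Sum.inr snd) (ra .t)) (push (ra .s) false) skip)

/-- `nUnpair src fst snd`: `(fst, snd) := boolUnpair src` (exactly, on every input; `fst`, `snd`
must be empty; `src` is consumed). [Arora–Barak 2009, §0.1] [folklore] -/
def nUnpair (src fst snd : β) : Com (EReg ⊕ β) :=
  unpairLoop src snd ;; pour (ra .s) (Sum.inr fst)

/-- Simulation of the loop of `nUnpair`. [folklore] -/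
theorem runs_unpairLoop {src snd : β} (hss : src ≠ snd) :
    ∀ (w acc : List Bool) (T : Regs β), T src = w → T snd = [] →
      Runs (unpairLoop src snd) (nst (AReg.file [] [] [] acc [] [] [] []) mClean eClean T)
        (nst (AReg.file [] [] [] ((boolUnpair w).1.reverse ++ acc) [] [] [] []) mClean eClean
          (Function.update (Function.update T src []) snd (boolUnpair w).2))
        (6 * w.length + 6)
  | [], acc, T, hw, hs => by
    have e : Function.update (Function.update T src []) snd [] = T := by
      (funext i; simp only [Function.update_apply]; split_ifs <;> simp_all)
    refine (Runs.loop_nil _ _ (by simp [hw])).of_eq ?_ (by simp)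
    simp [boolUnpair_nil, e]
  | [b], acc, T, hw, hs => by
    have e : Function.update (Function.update T src []) snd [] = Function.update T src [] := by
      (funext i; simp only [Function.update_apply]; split_ifs <;> simp_all)
    have hfin : Runs (unpairLoop src snd) (nst (AReg.file [] [] [] acc [] [] [] []) mClean eClean (Function.update T src []))
        (nst (AReg.file [] [] [] acc [] [] [] []) mClean eClean (Function.update T src [])) 1 :=
      Runs.loop_nil _ _ (by simp)
    have hb : ∀ ct cf : Com (EReg ⊕ β), Runs (pop (Sum.inr src) ct cf skip)
        (nst (AReg.file [] [] [] acc [] [] [] []) mClean eClean (Function.update T src []))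
        (nst (AReg.file [] [] [] acc [] [] [] []) mClean eClean (Function.update T src [])) (0 + 2) :=
      fun ct cf => Runs.pop_nil _ _ (by simp) (Runs.skip _)
    cases b
    · refine (Runs.loop_false' (w := []) (by simp [hw]) (by simp) (hb _ _) hfin).of_eq ?_ (by norm_num)
      simp [boolUnpair_singleton, e]
    · refine (Runs.loop_true' (w := []) (by simp [hw]) (by simp) (hb _ _) hfin).of_eq ?_ (by norm_num)
      simp [boolUnpair_singleton, e]
  | b :: b' :: rest, acc, T, hw, hs => by
    have hsnd' : ∀ v : List Bool, (Function.update T src v) snd = [] := fun v => by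
      simp [Function.update_of_ne hss.symm, hs]
    have hfinE : ∀ T' : Regs β, T' src = [] →
        Runs (unpairLoop src snd) (nst (AReg.file [] [] [] acc [] [] [] []) mClean eClean T')
          (nst (AReg.file [] [] [] acc [] [] [] []) mClean eClean T') 1 :=
      fun T' h => Runs.loop_nil _ _ (by simp [h])
    have e : Function.update (Function.update T src []) snd [] = Function.update T src [] := by
      (funext i; simp only [Function.update_apply]; split_ifs <;> simp_all)
    have hemit : ∀ c : Bool, Runs (push (ra .s) c)
        (nst (AReg.file [] [] [] acc [] [] [] []) mClean eClean (Function.update T src rest))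
        (nst (AReg.file [] [] [] (c :: acc) [] [] [] []) mClean eClean (Function.update T src rest)) 1 :=
      fun c => Runs.push' (by simp)
    have hupd : ∀ c : Bool, Function.update (nst (AReg.file [] [] [] acc [] [] [] []) mClean eClean
        (Function.update T src (c :: rest))) (Sum.inr src) rest =
        nst (AReg.file [] [] [] acc [] [] [] []) mClean eClean (Function.update T src rest) := fun c => by simp
    have hupd₀ : ∀ v : List Bool, Function.update (nst (AReg.file [] [] [] acc [] [] [] []) mClean eClean T)
        (Sum.inr src) v = nst (AReg.file [] [] [] acc [] [] [] []) mClean eClean (Function.update T src v) :=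
      fun v => by simp
    cases b <;> cases b'
    · -- `00`: emit `false`
      have hbr : Runs (pop (Sum.inr src) (move (Sum.inr src) (Sum.inr snd) (ra .t)) (push (ra .s) false) skip)
          (nst (AReg.file [] [] [] acc [] [] [] []) mClean eClean (Function.update T src (false :: rest)))
          (nst (AReg.file [] [] [] (false :: acc) [] [] [] []) mClean eClean (Function.update T src rest)) (1 + 2) :=
        Runs.pop_false' _ _ (w := rest) (by simp) (hupd false) (hemit false)
      have ih := runs_unpairLoop hss rest (false :: acc) (Function.update T src rest) (by simp) (hsnd' _)
      refine (Runs.loop_false' (w := false :: rest) (by simp [hw]) (hupd₀ _) hbr ih).of_eq ?_ ?_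
      · simp [boolUnpair_cons_cons]
      · simp only [List.length_cons]; omega
    · -- `01`: separator
      have hmv : Runs (move (Sum.inr src) (Sum.inr snd) (ra .t))
          (nst (AReg.file [] [] [] acc [] [] [] []) mClean eClean (Function.update T src rest))
          (nst (AReg.file [] [] [] acc [] [] [] []) mClean eClean (Function.update (Function.update T src []) snd rest))
          (6 * rest.length + 2) :=
        (runs_move (by simp [hss]) (by simp [ra]) (by simp [ra]) _ rfl).of_eq (by simp [hsnd']) (by simp)
      have hbr : Runs (pop (Sum.inr src) (move (Sum.inr src) (Sum.inr snd) (ra .t)) (push (ra .s) false) skip)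
          (nst (AReg.file [] [] [] acc [] [] [] []) mClean eClean (Function.update T src (true :: rest)))
          (nst (AReg.file [] [] [] acc [] [] [] []) mClean eClean (Function.update (Function.update T src []) snd rest))
          ((6 * rest.length + 2) + 2) :=
        Runs.pop_true' _ _ (w := rest) (by simp) (hupd true) hmv
      refine (Runs.loop_false' (w := true :: rest) (by simp [hw]) (hupd₀ _) hbr
        (hfinE _ (by simp [Function.update_of_ne hss]))).of_eq ?_ ?_
      · simp [boolUnpair_cons_cons]
      · simp only [List.length_cons]; omega
    · -- `10`: junk
      have hcl : Runs (clear (Sum.inr src))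
          (nst (AReg.file [] [] [] acc [] [] [] []) mClean eClean (Function.update T src rest))
          (nst (AReg.file [] [] [] acc [] [] [] []) mClean eClean (Function.update T src [])) (2 * rest.length + 1) :=
        (runs_clear (Sum.inr src) _).of_eq (by simp) (by simp)
      have hbr : Runs (pop (Sum.inr src) (push (ra .s) true) (clear (Sum.inr src)) skip)
          (nst (AReg.file [] [] [] acc [] [] [] []) mClean eClean (Function.update T src (false :: rest)))
          (nst (AReg.file [] [] [] acc [] [] [] []) mClean eClean (Function.update T src [])) ((2 * rest.length + 1) + 2) :=
        Runs.pop_false' _ _ (w := rest) (by simp) (hupd false) hcl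
      refine (Runs.loop_true' (w := false :: rest) (by simp [hw]) (hupd₀ _) hbr (hfinE _ (by simp))).of_eq ?_ ?_
      · simp [boolUnpair_cons_cons, e]
      · simp only [List.length_cons]; omega
    · -- `11`: emit `true`
      have hbr : Runs (pop (Sum.inr src) (push (ra .s) true) (clear (Sum.inr src)) skip)
          (nst (AReg.file [] [] [] acc [] [] [] []) mClean eClean (Function.update T src (true :: rest)))
          (nst (AReg.file [] [] [] (true :: acc) [] [] [] []) mClean eClean (Function.update T src rest)) (1 + 2) :=
        Runs.pop_true' _ _ (w := rest) (by simp) (hupd true) (hemit true)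
      have ih := runs_unpairLoop hss rest (true :: acc) (Function.update T src rest) (by simp) (hsnd' _)
      refine (Runs.loop_true' (w := true :: rest) (by simp [hw]) (hupd₀ _) hbr ih).of_eq ?_ ?_
      · simp [boolUnpair_cons_cons]
      · simp only [List.length_cons]; omega

/-- **Simulation of `nUnpair`**: exactly `boolUnpair`, in `9|src| + 7` steps.
[Arora–Barak 2009, §0.1] [folklore] -/
theorem runs_nUnpair {src fst snd : β} (hsf : src ≠ fst) (hss : src ≠ snd) (hfs : fst ≠ snd) (T : Regs β)
    (hf : T fst = []) (hs : T snd = []) :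
    Runs (nUnpair src fst snd) (base T)
      (base (Function.update (Function.update (Function.update T src []) fst (boolUnpair (T src)).1) snd
        (boolUnpair (T src)).2)) (9 * (T src).length + 7) := by
  set w := T src
  have h1 := runs_unpairLoop hss w [] T rfl hs
  rw [List.append_nil] at h1
  have h2 : Runs (pour (ra .s) (Sum.inr fst))
      (nst (AReg.file [] [] [] (boolUnpair w).1.reverse [] [] [] []) mClean eClean
        (Function.update (Function.update T src []) snd (boolUnpair w).2))
      (base (Function.update (Function.update (Function.update T src []) fst (boolUnpair w).1) snd (boolUnpair w).2))
      (3 * (boolUnpair w).1.length + 1) := by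
    refine (runs_pour (by simp [ra]) _).of_eq ?_ (by simp)
    simp only [update_nst_ra, update_nst_inr, nst_ra, nst_inr, AReg.file_s, AReg.update_file_s, List.reverse_reverse]
    congr 1
    (funext i; simp only [Function.update_apply]; split_ifs <;> simp_all)
  have hl : 2 * (boolUnpair w).1.length ≤ w.length :=
    (Nat.le_add_right _ _).trans (length_boolUnpair_parts_le w)
  exact (h1.seq h2).of_eq rfl (by omega)

/-- `nPairOnto src dst`: `dst := boolPair src dst`, consuming `src`. [Arora–Barak 2009, §0.1] [folklore] -/
def nPairOnto (src dst : β) : Com (EReg ⊕ β) :=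
  push (Sum.inr dst) true ;; push (Sum.inr dst) false ;; pour (Sum.inr src) (ra .s) ;;
  loop (ra .s) (push (Sum.inr dst) true ;; push (Sum.inr dst) true) (push (Sum.inr dst) false ;; push (Sum.inr dst) false)

/-- The doubling loop of `nPairOnto`. [folklore] -/
theorem runs_nPairOnto_loop (dst : β) :
    ∀ (v : List Bool) (T : Regs β),
      Runs (loop (ra .s) (push (Sum.inr dst) true ;; push (Sum.inr dst) true)
          (push (Sum.inr dst) false ;; push (Sum.inr dst) false))
        (nst (AReg.file [] [] [] v [] [] [] []) mClean eClean T)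
        (base (Function.update T dst ((v.reverse.flatMap fun b => [b, b]) ++ T dst))) (5 * v.length + 1)
  | [], T => (Runs.loop_nil _ _ (by simp)).of_eq (by simp) (by simp)
  | c :: v, T => by
    have ih := runs_nPairOnto_loop dst v (Function.update T dst (c :: c :: T dst))
    have hbody : ∀ c : Bool, Runs (push (Sum.inr dst) c ;; push (Sum.inr dst) c)
        (nst (AReg.file [] [] [] v [] [] [] []) mClean eClean T)
        (nst (AReg.file [] [] [] v [] [] [] []) mClean eClean (Function.update T dst (c :: c :: T dst))) (1 + 1) :=
      fun c => ((Runs.push' rfl).seq (Runs.push' rfl)).of_eq (by simp) le_rfl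
    cases c
    · refine (Runs.loop_false' (w := v) (by simp) (by simp) (hbody false) ih).of_eq ?_ (by simp; omega)
      simp
    · refine (Runs.loop_true' (w := v) (by simp) (by simp) (hbody true) ih).of_eq ?_ (by simp; omega)
      simp

/-- **Simulation of `nPairOnto`**: `dst := boolPair src dst`, in `8|src| + 4` steps.
[Arora–Barak 2009, §0.1] [folklore] -/
theorem runs_nPairOnto {src dst : β} (hsd : src ≠ dst) (T : Regs β) :
    Runs (nPairOnto src dst) (base T)
      (base (Function.update (Function.update T src []) dst (boolPair (T src) (T dst)))) (8 * (T src).length + 4) := by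
  set x := T src
  have h1a : Runs (push (Sum.inr dst) true) (base T) (base (Function.update T dst (true :: T dst))) 1 :=
    Runs.push' (by simp)
  have h1b : Runs (push (Sum.inr dst) false) (base (Function.update T dst (true :: T dst)))
      (base (Function.update T dst (false :: true :: T dst))) 1 :=
    Runs.push' (by simp)
  have h2 : Runs (pour (Sum.inr src) (ra .s)) (base (Function.update T dst (false :: true :: T dst)))
      (nst (AReg.file [] [] [] x.reverse [] [] [] []) mClean eClean
        (Function.update (Function.update T dst (false :: true :: T dst)) src [])) (3 * x.length + 1) :=
    (runs_pour (by simp [ra]) _).of_eq (by simp [Function.update_of_ne hsd, x]) (by simp [Function.update_of_ne hsd, x])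
  have h3 := runs_nPairOnto_loop dst x.reverse (Function.update (Function.update T dst (false :: true :: T dst)) src [])
  refine (h1a.seq (h1b.seq (h2.seq h3))).of_eq ?_ ?_
  · simp only [List.reverse_reverse]
    congr 1
    funext i; simp only [Function.update_apply]; split_ifs <;> simp_all [boolPair]
  · simp only [List.length_reverse]; omega

/-! ### Unary counters and lengths -/

/-- One step of reading a binary numeral most significant bit first. [folklore] -/
def unStep (N : ℕ) (b : Bool) : ℕ := 2 * N + b.toNat

/-- Reading the reversed string accumulates the value. [folklore] -/
theorem foldl_unStep_reverse (N : ℕ) (w : List Bool) :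
    (w.reverse).foldl unStep N = N * 2 ^ w.length + bitsToNat w := by
  induction w generalizing N with
  | nil => simp
  | cons b w ih =>
    rw [List.reverse_cons, List.foldl_append, ih]
    simp [unStep, bitsToNat_cons, pow_succ]; ring

/-- The accumulator only grows. [folklore] -/
theorem le_foldl_unStep (N : ℕ) (v : List Bool) : N ≤ v.foldl unStep N := by
  induction v generalizing N with
  | nil => simp
  | cons b v ih => exact le_trans (by unfold unStep; omega) (ih _)

/-- The doubling step of `nToUnary`: `dst := dst ++ dst`. [folklore] -/
def unDouble (dst : β) : Com (EReg ⊕ β) :=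
  copy (Sum.inr dst) (ra .x) (ra .t) (ra .u) ;; move (ra .x) (Sum.inr dst) (ra .z)

/-- `nToUnary dst src`: `dst := 1^(value of src)` (`dst` must be empty; `src` is kept).
[folklore] -/
def nToUnary (dst src : β) : Com (EReg ⊕ β) :=
  copy (Sum.inr src) (ra .y) (ra .t) (ra .u) ;; pour (ra .y) (ra .s) ;;
  loop (ra .s) (unDouble dst ;; push (Sum.inr dst) true) (unDouble dst)

/-- The loop of `nToUnary` from accumulator `N` (in unary in `dst`) over the remaining most
significant bits `v`, ending with `F = foldl unStep N v` marks, in `|v| (16 F + 8) + 1` steps.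
[folklore] -/
theorem runs_nToUnary_loop (dst : β) :
    ∀ (v : List Bool) (N : ℕ) (T : Regs β), T dst = List.replicate N true →
      Runs (loop (ra .s) (unDouble dst ;; push (Sum.inr dst) true) (unDouble dst))
        (nst (AReg.file [] [] [] v [] [] [] []) mClean eClean T)
        (base (Function.update T dst (List.replicate (v.foldl unStep N) true)))
        (v.length * (16 * v.foldl unStep N + 8) + 1)
  | [], N, T, hT => (Runs.loop_nil _ _ (by simp)).of_eq (by simp [← hT]) (by simp)
  | c :: v, N, T, hT => by
    have hNF : unStep N c ≤ (c :: v).foldl unStep N := le_foldl_unStep _ _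
    have hN : N ≤ unStep N c := by unfold unStep; omega
    have hdbl : Runs (unDouble dst) (nst (AReg.file [] [] [] v [] [] [] []) mClean eClean T)
        (nst (AReg.file [] [] [] v [] [] [] []) mClean eClean (Function.update T dst (List.replicate (N + N) true)))
        ((10 * N + 3) + (6 * N + 2)) := by
      have hc : Runs (copy (Sum.inr dst) (ra .x) (ra .t) (ra .u)) (nst (AReg.file [] [] [] v [] [] [] []) mClean eClean T)
          (nst (AReg.file (List.replicate N true) [] [] v [] [] [] []) mClean eClean T) (10 * N + 3) :=
        (runs_copy (by simp [ra]) (by simp [ra]) (by simp [ra]) (by simp [ra]) (by simp [ra]) (by simp [ra]) _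
          rfl rfl).of_eq (by simp [hT]) (by simp [hT])
      have hm : Runs (move (ra .x) (Sum.inr dst) (ra .z)) (nst (AReg.file (List.replicate N true) [] [] v [] [] [] []) mClean eClean T)
          (nst (AReg.file [] [] [] v [] [] [] []) mClean eClean (Function.update T dst (List.replicate (N + N) true)))
          (6 * N + 2) :=
        (runs_move (by simp [ra]) (by simp [ra]) (by simp [ra]) _ rfl).of_eq
          (by simp [hT]) (by simp)
      exact hc.seq hm
    cases c
    · have ih := runs_nToUnary_loop dst v (unStep N false) (Function.update T dst (List.replicate (N + N) true))
        (by simp [unStep, two_mul])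
      refine (Runs.loop_false' (w := v) (by simp) (by simp) hdbl ih).of_eq ?_ ?_
      · simp [List.foldl_cons]
      · have e : (false :: v).foldl unStep N = v.foldl unStep (unStep N false) := rfl
        rw [e] at hNF ⊢
        simp only [List.length_cons]
        nlinarith [hNF, hN]
    · have hp : Runs (push (Sum.inr dst) true)
          (nst (AReg.file [] [] [] v [] [] [] []) mClean eClean (Function.update T dst (List.replicate (N + N) true)))
          (nst (AReg.file [] [] [] v [] [] [] []) mClean eClean (Function.update T dst (List.replicate (N + N + 1) true))) 1 :=
        Runs.push' (by simp [List.replicate_succ])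
      have ih := runs_nToUnary_loop dst v (unStep N true) (Function.update T dst (List.replicate (N + N + 1) true))
        (by simp [unStep, two_mul])
      refine (Runs.loop_true' (w := v) (by simp) (by simp) (hdbl.seq hp) ih).of_eq ?_ ?_
      · simp [List.foldl_cons]
      · have e : (true :: v).foldl unStep N = v.foldl unStep (unStep N true) := rfl
        rw [e] at hNF ⊢
        simp only [List.length_cons]
        nlinarith [hNF, hN]

/-- **Simulation of `nToUnary`**: `dst := 1^(value of src)`, in `|src| (16 V + 21) + 5` steps,
`V` the value. [folklore] -/
theorem runs_nToUnary (dst src : β) (T : Regs β) (hd : T dst = []) :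
    Runs (nToUnary dst src) (base T)
      (base (Function.update T dst (List.replicate (bitsToNat (T src)) true)))
      ((T src).length * (16 * bitsToNat (T src) + 21) + 5) := by
  set w := T src
  have h1 : Runs (copy (Sum.inr src) (ra .y) (ra .t) (ra .u)) (base T)
      (nst (AReg.file [] w [] [] [] [] [] []) mClean eClean T) (10 * w.length + 3) :=
    (runs_copy (by simp [ra]) (by simp [ra]) (by simp [ra]) (by simp [ra]) (by simp [ra]) (by simp [ra]) (base T)
      rfl rfl).of_eq (by simp [w]) (by simp [w])
  have h2 : Runs (pour (ra .y) (ra .s)) (nst (AReg.file [] w [] [] [] [] [] []) mClean eClean T)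
      (nst (AReg.file [] [] [] w.reverse [] [] [] []) mClean eClean T) (3 * w.length + 1) :=
    (runs_pour (by simp [ra]) _).of_eq (by simp) (by simp)
  have h3 := runs_nToUnary_loop dst w.reverse 0 T (by simp [hd])
  rw [foldl_unStep_reverse, zero_mul, zero_add, List.length_reverse] at h3
  refine (h1.seq (h2.seq h3)).of_eq rfl ?_
  nlinarith

/-- `nLen dst src tmp`: `dst :=` numeral of the length of `src` (`tmp` scratch, empty).
[folklore] -/
def nLen (dst src tmp : β) : Com (EReg ⊕ β) :=
  clear (Sum.inr dst) ;; copy (Sum.inr src) (Sum.inr tmp) (ra .t) (ra .u) ;; loop (Sum.inr tmp) (nSucc dst dst) (nSucc dst dst)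

/-- **Simulation of `nLen`**, in `90 (n + 1)²` steps when `|src|, |dst| ≤ n`. [folklore] -/
theorem runs_nLen {dst src tmp : β} (hds : dst ≠ src) (hdt : dst ≠ tmp) (hst : src ≠ tmp) (T : Regs β) {n : ℕ}
    (hs : (T src).length ≤ n) (hd : (T dst).length ≤ n) (ht : T tmp = []) :
    Runs (nLen dst src tmp) (base T) (base (Function.update T dst (encodeNat (T src).length))) (90 * (n + 1) ^ 2) := by
  set w := T src
  set T₁ := Function.update T dst [] with hT₁
  have h0 : Runs (clear (Sum.inr dst)) (base T) (base T₁) (2 * (T dst).length + 1) :=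
    (runs_clear (Sum.inr dst) _).of_eq (by simp [T₁]) (by simp)
  have h1 : Runs (copy (Sum.inr src) (Sum.inr tmp) (ra .t) (ra .u)) (base T₁) (base (Function.update T₁ tmp w))
      (10 * w.length + 3) :=
    (runs_copy (by simp [hst]) (by simp [ra]) (by simp [ra]) (by simp [ra]) (by simp [ra]) (by simp [ra]) (base T₁)
      rfl rfl).of_eq
      (by simp [T₁, Function.update_of_ne hds.symm, Function.update_of_ne (Ne.symm hdt), ht, w])
      (by simp [T₁, Function.update_of_ne hds.symm, w])
  -- the counted loop
  let S : ℕ → Regs (EReg ⊕ β) := fun j => base (Function.update (Function.update T tmp []) dst (encodeNat j))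
  have hS : ∀ j, S j (Sum.inr tmp) = [] := fun j => by simp [S, Function.update_of_ne (Ne.symm hdt)]
  have hbody : ∀ j (v : List Bool), j < w.length →
      Runs (nSucc dst dst) (Function.update (S j) (Sum.inr tmp) v) (Function.update (S (j + 1)) (Sum.inr tmp) v) (72 * (n + 1)) := by
    intro j v hj
    have hjl : (encodeNat j).length ≤ n := (length_encodeNat_le_self j).trans (by omega)
    set Tj := Function.update (Function.update (Function.update T tmp []) dst (encodeNat j)) tmp v with hTj
    have hTjd : Tj dst = encodeNat j := by simp [Tj, Function.update_of_ne hdt]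
    have e1 : Function.update (S j) (Sum.inr tmp) v = base Tj := by simp only [S, Tj, update_nst_inr]
    have e2 : Function.update (S (j + 1)) (Sum.inr tmp) v = base (Function.update Tj dst (encodeNat (j + 1))) := by
      simp only [S, Tj, update_nst_inr]
      congr 1
      (funext i; simp only [Function.update_apply]; split_ifs <;> simp_all)
    rw [e1, e2]
    have := runs_nSucc dst dst Tj (n := n) (by rw [hTjd]; exact hjl) (by rw [hTjd]; omega)
    rw [hTjd, bitsToNat_encodeNat] at this
    exact this
  have h2 := runs_loop_count S (72 * (n + 1)) w.length hS hbody w 0 (by simp)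
  have e0 : Function.update (S 0) (Sum.inr tmp) w = base (Function.update T₁ tmp w) := by
    simp only [S, update_nst_inr, T₁]
    congr 1
    funext i; simp only [Function.update_apply]; split_ifs <;> simp_all [encodeNat_zero]
  have efin : S (0 + w.length) = base (Function.update T dst (encodeNat w.length)) := by
    simp only [S, zero_add]
    congr 1
    (funext i; simp only [Function.update_apply]; split_ifs <;> simp_all)
  rw [e0, efin] at h2
  refine (h0.seq (h1.seq h2)).of_eq rfl ?_
  nlinarith

end Com

end Literature.Computability.Complexity
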